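import Mathlib
import HarnessLib
import Literature.NumberTheory.LFunctions.RHWave0

/-!
# Hardy's theorem: infinitely many zeros of `ζ` on the critical line — proved

Topic `Literature/NumberTheory/LFunctions` (trunk T-ANT, family `rh`). Sibling proof file of
`RHWave0.lean`: it discharges the named fact

* `Literature.NumberTheory.LFunctions.hardy_infinite_zeros_on_critical_line` (**rh.S14**, Hardy 1914):
  `{t : ℝ | ζ(1/2 + it) = 0}` is infinite,

as `Literature.NumberTheory.LFunctions.hardy_infinite_zeros_on_critical_line_holds`, from Mathlib's theory of the completed
zeta function (`completedRiemannZeta`, the Hurwitz/Jacobi theta kernels and their functional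
equation), the Fourier transform on `ℝ`, the Gaussian approximate identity and the Cauchy–Goursat
theorem for rectangles. No result is assumed: the file is sorry- and axiom-free beyond Mathlib.

## Sources

* G. H. Hardy, *Sur les zéros de la fonction `ζ(s)` de Riemann*, C. R. Acad. Sci. Paris **158**
  (1914), 1012–1014 — the theorem. [cite: Hardy1914, C. R. Acad. Sci. Paris 158 (1914) 1012–1014]
* E. C. Titchmarsh, *The Theory of the Riemann Zeta-Function*, 2nd ed. (rev. D. R. Heath-Brown),
  Oxford 1986, §10.2 "first method" (Hardy's own proof), with §2.6 (theta function, (2.6.1)–(2.6.4))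
  and §2.16 ((2.16.1)–(2.16.2): `∫₀^∞ Ξ(t)/(t²+¼) cos xt dt = ½π{e^{½x} - 2e^{-½x}ψ(e^{-2x})}`).
  [cite: Titchmarsh1986, §10.2]

## The argument (Titchmarsh §10.2, in a Stirling-free arrangement)

Write `θ(x) = ∑_{n ∈ ℤ} e^{-π n² x}` and `Λ(s) = π^{-s/2} Γ(s/2) ζ(s)` (`completedRiemannZeta`).
Put `Φ(u) = e^{u/4} θ(e^u) - e^{u/4} - e^{-u/4}` (`hardyKernel`; this is `-(2/π)×` the right-hand
side of (2.16.2) at `x = -u/2`). Then: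

1. (`completedRiemannZeta_eq_mellin_riemannIntegrand`, `completedRiemannZeta_critical_line`;
   Titchmarsh §2.6, §2.16) `Λ(s) = ½ ∫₀^∞ (θ(x) - 1 - x^{-1/2}) x^{s/2-1} dx` on `0 < re s < 1`,
   whence, substituting `x = e^{-u}`, `Λ(½ + it) = ½ 𝓕Φ(t/4π)` (Mathlib's `𝓕`, `mellin_eq_fourier`).
   In particular `t ↦ Λ(½ + it)` is real (`Φ` is real and even) and its zeros are those of
   `ζ(½ + it)` (`Gammaℝ ≠ 0`).
2. (`hardyKernel_neg`, `differentiableAt_hardyKernel`, `norm_hardyKernel_le`) By the theta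
   functional equation `Φ` is even and holomorphic on the strip `|im u| < π/2`
   (Titchmarsh §10.4), with `|Φ(x+iy)| ≤ M(y₁) e^{-|x|/4}` for `|y| ≤ y₁ < π/2`.
3. (`tendsto_integral_fourier_hardyKernelReal_mul_tiltedGaussian`) For `|y| < π/2`,
   `∫ 𝓕Φ(ξ) e^{2π y ξ} e^{-ξ²/C} dξ ⟶ Φ(iy)` as `C → ∞`: by the multiplication formula the
   left side is `∫ Φ · 𝓕(Gaussian)`, the Fourier transform of the tilted Gaussian is a Gaussian
   centred at `-iy` (`fourier_gaussian_pi'`), the line of integration is moved to `im = -y`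
   by Cauchy–Goursat on rectangles (`integral_eq_integral_add_mul_I`), and the centred Gaussians
   are an approximate identity (`Real.tendsto_integral_gaussian_smul'`). This replaces
   Titchmarsh's differentiation of (10.2.1) under the integral sign (which needs
   `Ξ(t) = O(tᴬ e^{-πt/4})`, i.e. Stirling's formula, not available in Mathlib); positivity is only
   used at the very end, exactly as in §10.2.
4. (`norm_hardyTheta_mul_I_small`; Titchmarsh §10.2, "`½ + ψ(x)` and all its derivatives tend
   to zero as `x → i`") On the imaginary axis `Φ(iy) = A(iy) - 2cos(y/4)` where the theta part
   `A(iy) = e^{iy/4} θ(e^{iy})` is `O((π/2 - y)^N)` for every `N` as `y ↑ π/2`: by the half-period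
   shift `θ(0 | τ) = θ(½ | τ + 1)` and the Jacobi transformation formula,
   `|θ(e^{iy})| ≤ |w|^{-1/2} θ_{1/2}(im w/|w|²)`, `w = 1 + i e^{iy} → 0`.
5. (`fourier_hardyKernelReal_zeros_infinite`) If `𝓕Φ` had finitely many zeros it would have a
   constant sign `σ` for `|ξ| ≥ T`. Test against the nonnegative weights
   `e^{2π y₀ ξ}(e^{2πkξ} - 1)^{2n} e^{-ξ²/C} = ∑ⱼ C(2n,j)(-1)^j e^{2π yⱼ ξ} e^{-ξ²/C}`,
   `yⱼ = y₀ + jk`, `y₀ = π/2 - 2η`, `k = η/2n` (the moments `t^{2n}` of §10.2 replaced by `2n`-th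
   differences, so that only step 3 is needed). As `C → ∞` the tested integrals tend to
   `σ ∑ⱼ C(2n,j)(-1)^j Φ(iyⱼ)`, whose real part is
   `σ ∑ⱼ C(2n,j)(-1)^j re A(iyⱼ) - 2σ(-4)ⁿ sin^{2n}(k/8) cos((y₀+nk)/4) < 0` once the parity of
   `n` matches `σ` and `η` is small (step 4); but they are eventually
   `≥ m(e^{4πkT}-1)^{2n}/2 - 2T‖Φ‖₁e^{π²T}(e^{2πkT}-1)^{2n} ≥ (e^{2πkT}-1)^{2n}(4ⁿm - 2T‖Φ‖₁e^{π²T}) > 0`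
   for `n` large (`m = min_{[2T,2T+1]} σ𝓕Φ > 0`) — Titchmarsh's `m 2^{2n} < K`. Contradiction.

## Main declarations (all in `Literature.RH.Hardy`, all proved)

* `thetaI`, `hardyTheta`, `hardyKernel`, `hardyKernelReal`, `hardyF = re ∘ 𝓕 hardyKernelReal`;
* `completedRiemannZeta_eq_mellin_riemannIntegrand`, `completedRiemannZeta_critical_line`;
* `integral_eq_integral_add_mul_I` (shifting the line of integration across a strip);
* `norm_jacobiTheta₂_le_of_near_neg_one` (theta near the cusp `-1`);
* `fourier_hardyKernelReal_zeros_infinite`, `riemannZeta_zeros_on_critical_line_infinite`;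
* `Literature.NumberTheory.LFunctions.hardy_infinite_zeros_on_critical_line_holds`.

## Design notes

* Everything is stated over Mathlib's objects (`riemannZeta`, `completedRiemannZeta`,
  `HurwitzZeta.evenKernel`, `jacobiTheta₂`, `Real.fourierIntegral`); the kernel `Φ` is introduced
  only as a proof device and is independent of `Literature.NumberTheory.LFunctions.deBruijnPhi`/`RiemannXi.lean` (which encode
  `Ξ(t)` itself, Titchmarsh (10.1.2)–(10.1.4), rather than `Ξ(t)/(t²+¼)`).
* Normalisations: `𝓕f(ξ) = ∫ f(v) e^{-2πivξ} dv`; the strip is `|im u| < π/2` (Titchmarsh's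
  `|im u| < π/4` in the variable `u/2`).
-/

noncomputable section

open Complex Real MeasureTheory Filter Topology Set HurwitzZeta
open scoped FourierTransform ComplexConjugate Interval

namespace Literature.NumberTheory.LFunctions.Hardy

/-- `thetaI w = ∑ₙ exp (-π n² w)` (for `0 < re w`), realised as `jacobiTheta₂ 0 (I * w)`.
[cite: Titchmarsh1986, §2.6 (2.6.1)] -/
def thetaI (w : ℂ) : ℂ := jacobiTheta₂ 0 (I * w)

/-- `im (I w) = re w`. [folklore] -/
lemma I_mul_im (w : ℂ) : (I * w).im = w.re := by simp

/-- `thetaI` is holomorphic on the right half-plane `0 < re w`. [folklore] -/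
lemma differentiableAt_thetaI {w : ℂ} (hw : 0 < w.re) : DifferentiableAt ℂ thetaI w := by
  have h : 0 < (I * w).im := by simpa using hw
  change DifferentiableAt ℂ (fun w ↦ jacobiTheta₂ 0 (I * w)) w
  exact (differentiableAt_jacobiTheta₂_snd 0 h).comp w ((differentiableAt_id.const_mul I))

/-- `thetaI` is continuous on the right half-plane. [folklore] -/
lemma continuousAt_thetaI {w : ℂ} (hw : 0 < w.re) : ContinuousAt thetaI w :=
  (differentiableAt_thetaI hw).continuousAt

/-- The theta functional equation `thetaI w = w^{-1/2} thetaI (1/w)`.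
[cite: Titchmarsh1986, §2.6 (2.6.3)] -/
lemma thetaI_functional_equation (w : ℂ) : thetaI w = 1 / w ^ (1 / 2 : ℂ) * thetaI (1 / w) := by
  unfold thetaI
  rw [jacobiTheta₂_functional_equation 0 (I * w)]
  have h1 : -I * (I * w) = w := by rw [← mul_assoc, neg_mul, I_mul_I, neg_neg, one_mul]
  have h2 : -1 / (I * w) = I * (1 / w) := by
    rw [← div_div, neg_div, div_I]
    simp [div_eq_mul_inv]
  simp [h1, h2]

/-- `thetaI` commutes with complex conjugation. [folklore] -/
lemma thetaI_conj (w : ℂ) : conj (thetaI w) = thetaI (conj w) := by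
  unfold thetaI
  rw [jacobiTheta₂_conj]
  simp

/-- Exponential closeness of `thetaI w` to `1` for `re w > 0`. [folklore] -/
lemma norm_thetaI_sub_one_le {w : ℂ} (hw : 0 < w.re) :
    ‖thetaI w - 1‖ ≤ 2 / (1 - rexp (-π * w.re)) * rexp (-π * w.re) := by
  have h : 0 < (I * w).im := by simpa using hw
  have := norm_jacobiTheta_sub_one_le h
  simpa [thetaI, jacobiTheta_eq_jacobiTheta₂] using this

/-- `hardyTheta u = e^{u/4} thetaI(e^u)`, the analytic (even) part of Hardy's kernel.
[cite: Titchmarsh1986, §2.16 (2.16.2)] -/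
def hardyTheta (u : ℂ) : ℂ := cexp (u / 4) * thetaI (cexp u)

/-- Hardy's kernel `hardyKernel u = e^{u/4} thetaI(e^u) - e^{u/4} - e^{-u/4}`.
[cite: Titchmarsh1986, §2.16 (2.16.2) and §10.2 (10.2.1)] -/
def hardyKernel (u : ℂ) : ℂ := hardyTheta u - (cexp (u / 4) + cexp (-(u / 4)))

/-- `e^u` has positive real part on the strip `|im u| < π/2`. [folklore] -/
lemma re_cexp_pos {u : ℂ} (hu : |u.im| < π / 2) : 0 < (cexp u).re := by
  rw [Complex.exp_re]
  exact mul_pos (Real.exp_pos _) (Real.cos_pos_of_mem_Ioo (abs_lt.mp hu))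

/-- The theta part `hardyTheta` is holomorphic on the strip `|im u| < π/2`. [folklore] -/
lemma differentiableAt_hardyTheta {u : ℂ} (hu : |u.im| < π / 2) :
    DifferentiableAt ℂ hardyTheta u := by
  unfold hardyTheta
  have h1 : DifferentiableAt ℂ (fun u ↦ thetaI (cexp u)) u :=
    (differentiableAt_thetaI (re_cexp_pos hu)).comp u differentiableAt_exp
  exact ((differentiableAt_id.div_const 4).cexp).mul h1

/-- Hardy's kernel is holomorphic on the strip `|im u| < π/2` (Titchmarsh §10.4: "`Φ(u)` is
regular for `-π/4 < I(u) < π/4`", in the rescaled variable). [folklore] -/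
lemma differentiableAt_hardyKernel {u : ℂ} (hu : |u.im| < π / 2) :
    DifferentiableAt ℂ hardyKernel u := by
  unfold hardyKernel
  refine (differentiableAt_hardyTheta hu).sub ?_
  exact ((differentiableAt_id.div_const 4).cexp).add ((differentiableAt_id.div_const 4).neg.cexp)

/-- Hardy's kernel is continuous on the strip `|im u| < π/2`. [folklore] -/
lemma continuousAt_hardyKernel {u : ℂ} (hu : |u.im| < π / 2) : ContinuousAt hardyKernel u :=
  (differentiableAt_hardyKernel hu).continuousAt

/-- `hardyTheta` is even on the strip `|im u| < π`. [folklore] -/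
lemma hardyTheta_neg {u : ℂ} (hu : |u.im| < π) : hardyTheta (-u) = hardyTheta u := by
  unfold hardyTheta
  rw [thetaI_functional_equation (cexp u)]
  have hsq : cexp u ^ (1 / 2 : ℂ) = cexp (u / 2) := by
    rw [cpow_def_of_ne_zero (Complex.exp_ne_zero u),
      Complex.log_exp (abs_lt.mp hu).1 (abs_lt.mp hu).2.le]
    congr 1; ring
  rw [hsq, one_div (cexp u), ← Complex.exp_neg]
  rw [← mul_assoc, one_div, ← Complex.exp_neg, ← Complex.exp_add]
  congr 2; ring

/-- Hardy's kernel is even on the strip `|im u| < π`. [folklore] -/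
lemma hardyKernel_neg {u : ℂ} (hu : |u.im| < π) : hardyKernel (-u) = hardyKernel u := by
  unfold hardyKernel
  rw [hardyTheta_neg hu]
  congr 1
  rw [neg_div, neg_neg, add_comm]

/-- `conj (u/4) = conj u / 4`. [folklore] -/
lemma conj_div_four (u : ℂ) : conj (u / 4) = conj u / 4 := by
  rw [map_div₀, map_ofNat]

/-- The theta part commutes with complex conjugation. [folklore] -/
lemma hardyTheta_conj (u : ℂ) : conj (hardyTheta u) = hardyTheta (conj u) := by
  unfold hardyTheta
  rw [map_mul, thetaI_conj, ← Complex.exp_conj, ← Complex.exp_conj, conj_div_four]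

/-- Hardy's kernel commutes with complex conjugation (so it is real on `ℝ` and on `iℝ`).
[folklore] -/
lemma hardyKernel_conj (u : ℂ) : conj (hardyKernel u) = hardyKernel (conj u) := by
  unfold hardyKernel
  rw [map_sub, hardyTheta_conj, map_add, ← Complex.exp_conj, ← Complex.exp_conj, map_neg,
    conj_div_four]

/-- `hardyKernel` is real on the real axis. [folklore] -/
lemma hardyKernel_ofReal_im (x : ℝ) : (hardyKernel x).im = 0 := by
  have := hardyKernel_conj x
  rw [conj_ofReal] at this
  exact conj_eq_iff_im.mp this

/-- `hardyKernel` is real on the imaginary axis (inside the strip). [folklore] -/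
lemma hardyKernel_mul_I_im {y : ℝ} (hy : |y| < π) : (hardyKernel (y * I)).im = 0 := by
  have h1 := hardyKernel_conj (y * I)
  have h2 : conj ((y : ℂ) * I) = -(y * I) := by simp
  rw [h2, hardyKernel_neg (by simpa using hy)] at h1
  exact conj_eq_iff_im.mp h1


/-! ### Uniform exponential decay of `hardyKernel` on closed sub-strips -/

/-- `‖e^{u/4}‖ = e^{re u / 4}`. [folklore] -/
lemma norm_cexp_div_four (u : ℂ) : ‖cexp (u / 4)‖ = rexp (u.re / 4) := by
  rw [Complex.norm_exp]
  congr 1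
  simp

/-- `‖e^{-u/4}‖ = e^{-re u / 4}`. [folklore] -/
lemma norm_cexp_neg_div_four (u : ℂ) : ‖cexp (-(u / 4))‖ = rexp (-(u.re / 4)) := by
  rw [← neg_div, norm_cexp_div_four, neg_re, neg_div]

/-- `Φ(u) = e^{u/4}(θ(e^u) - 1) - e^{-u/4}`, the form exhibiting the decay as `re u → +∞`.
[folklore] -/
lemma hardyKernel_eq (u : ℂ) :
    hardyKernel u = cexp (u / 4) * (thetaI (cexp u) - 1) - cexp (-(u / 4)) := by
  unfold hardyKernel hardyTheta; ring

/-- Bound on the right half of a closed sub-strip. [folklore] -/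
lemma norm_hardyKernel_le_right {y₁ : ℝ} (hy₁ : 0 ≤ y₁) (hy₁' : y₁ < π / 2) :
    ∃ M : ℝ, 0 < M ∧
      ∀ u : ℂ, |u.im| ≤ y₁ → 0 ≤ u.re → ‖hardyKernel u‖ ≤ M * rexp (-(u.re / 4)) := by
  set c₁ := Real.cos y₁ with hc₁
  have hc₁pos : 0 < c₁ := Real.cos_pos_of_mem_Ioo ⟨by linarith [pi_pos], hy₁'⟩
  have hπc : 0 < π * c₁ := mul_pos pi_pos hc₁pos
  have hden : 0 < 1 - rexp (-π * c₁) := by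
    have : rexp (-π * c₁) < 1 := Real.exp_lt_one_iff.mpr (by nlinarith)
    linarith
  set K₁ := 2 / (1 - rexp (-π * c₁)) with hK₁def
  have hK₁ : 0 < K₁ := div_pos two_pos hden
  refine ⟨K₁ / (π * c₁) + 1, by positivity, fun u hu hx ↦ ?_⟩
  -- lower bound for the real part of `exp u`
  have hcos : c₁ ≤ Real.cos u.im := by
    rw [← Real.cos_abs u.im]
    exact Real.cos_le_cos_of_nonneg_of_le_pi (abs_nonneg _) (by linarith) hu
  have hexp1 : 1 ≤ rexp u.re := Real.one_le_exp hx
  have hr' : rexp u.re * c₁ ≤ (cexp u).re := by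
    rw [Complex.exp_re]
    exact mul_le_mul_of_nonneg_left hcos (Real.exp_pos _).le
  have hr : c₁ ≤ (cexp u).re := le_trans (by nlinarith) hr'
  have hr_pos : 0 < (cexp u).re := hc₁pos.trans_le hr
  -- bound ‖thetaI (exp u) - 1‖
  have hthetaI : ‖thetaI (cexp u) - 1‖ ≤ K₁ * rexp (-π * (rexp u.re * c₁)) := by
    refine (norm_thetaI_sub_one_le hr_pos).trans ?_
    have h1 : rexp (-π * (cexp u).re) ≤ rexp (-π * (rexp u.re * c₁)) :=
      Real.exp_le_exp.mpr (by nlinarith [pi_pos])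
    have h2 : 2 / (1 - rexp (-π * (cexp u).re)) ≤ K₁ := by
      have h3 : rexp (-π * (cexp u).re) ≤ rexp (-π * c₁) :=
        Real.exp_le_exp.mpr (by nlinarith [pi_pos])
      rw [hK₁def]
      exact div_le_div_of_nonneg_left zero_le_two hden (by linarith)
    exact mul_le_mul h2 h1 (Real.exp_pos _).le hK₁.le
  -- the key elementary inequality `e^{x/4} e^{-π c₁ e^x} ≤ e^{-x/4} / (π c₁)`
  have hkey : rexp (u.re / 4) * rexp (-π * (rexp u.re * c₁)) ≤ rexp (-(u.re / 4)) / (π * c₁) := by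
    rw [le_div_iff₀ hπc]
    have h1 : π * c₁ * rexp u.re ≤ rexp (π * c₁ * rexp u.re) := by
      linarith [Real.add_one_le_exp (π * c₁ * rexp u.re)]
    have h2 : rexp (u.re / 4) * rexp (-π * (rexp u.re * c₁)) * (π * c₁ * rexp u.re)
        ≤ rexp (u.re / 4) * rexp (-π * (rexp u.re * c₁)) * rexp (π * c₁ * rexp u.re) :=
      mul_le_mul_of_nonneg_left h1 (by positivity)
    have h3 : rexp (u.re / 4) * rexp (-π * (rexp u.re * c₁)) * rexp (π * c₁ * rexp u.re)
        = rexp (u.re / 4) := by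
      rw [mul_assoc, ← Real.exp_add]
      simp only [show -π * (rexp u.re * c₁) + π * c₁ * rexp u.re = 0 by ring, Real.exp_zero,
        mul_one]
    have h4 : rexp (u.re / 4) ≤ rexp (-(u.re / 4)) * rexp u.re := by
      rw [← Real.exp_add]
      exact Real.exp_le_exp.mpr (by linarith)
    calc rexp (u.re / 4) * rexp (-π * (rexp u.re * c₁)) * (π * c₁)
        = rexp (u.re / 4) * rexp (-π * (rexp u.re * c₁)) * (π * c₁ * rexp u.re)
            * (rexp u.re)⁻¹ := by
          field_simp
        _ ≤ rexp (u.re / 4) * (rexp u.re)⁻¹ := by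
          gcongr
          exact h2.trans h3.le
        _ ≤ rexp (-(u.re / 4)) := by
          rw [mul_inv_le_iff₀ (Real.exp_pos _)]
          exact h4
  rw [hardyKernel_eq]
  calc ‖cexp (u / 4) * (thetaI (cexp u) - 1) - cexp (-(u / 4))‖
      ≤ ‖cexp (u / 4) * (thetaI (cexp u) - 1)‖ + ‖cexp (-(u / 4))‖ := norm_sub_le _ _
    _ = rexp (u.re / 4) * ‖thetaI (cexp u) - 1‖ + rexp (-(u.re / 4)) := by
        rw [norm_mul, norm_cexp_div_four, norm_cexp_neg_div_four]
    _ ≤ rexp (u.re / 4) * (K₁ * rexp (-π * (rexp u.re * c₁))) + rexp (-(u.re / 4)) := by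
        gcongr
    _ = K₁ * (rexp (u.re / 4) * rexp (-π * (rexp u.re * c₁))) + rexp (-(u.re / 4)) := by ring
    _ ≤ K₁ * (rexp (-(u.re / 4)) / (π * c₁)) + rexp (-(u.re / 4)) := by gcongr
    _ = (K₁ / (π * c₁) + 1) * rexp (-(u.re / 4)) := by ring

/-- Uniform exponential decay of `hardyKernel` on the closed sub-strip `|im u| ≤ y₁ < π/2`.
[folklore] -/
lemma norm_hardyKernel_le {y₁ : ℝ} (hy₁ : 0 ≤ y₁) (hy₁' : y₁ < π / 2) :
    ∃ M : ℝ, 0 < M ∧ ∀ u : ℂ, |u.im| ≤ y₁ → ‖hardyKernel u‖ ≤ M * rexp (-(|u.re| / 4)) := by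
  obtain ⟨M, hM, h⟩ := norm_hardyKernel_le_right hy₁ hy₁'
  refine ⟨M, hM, fun u hu ↦ ?_⟩
  rcases le_or_gt 0 u.re with hx | hx
  · rw [abs_of_nonneg hx]; exact h u hu hx
  · have hπ : |u.im| < π := by linarith [pi_pos]
    rw [← hardyKernel_neg hπ, abs_of_neg hx]
    have := h (-u) (by simpa using hu) (by simp; linarith)
    simpa using this


/-! ### The integral representation of `Λ` on the critical strip and line -/

/-- On the reals, `thetaI` is Mathlib's `evenKernel 0` (`= ∑ₙ e^{-π n² x}` for `x > 0`).
[folklore] -/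
lemma thetaI_ofReal (x : ℝ) : thetaI x = (evenKernel 0 x : ℂ) := by
  rw [thetaI, evenKernel_eq_cosKernel_of_zero]
  have h := cosKernel_def 0 x
  simp only [ofReal_zero] at h
  rw [← h]
  norm_cast

/-- The real theta functional equation in the form `θ(e^{-u}) = e^{u/2} θ(e^u)`. [folklore] -/
lemma evenKernel_exp_neg (u : ℝ) :
    evenKernel 0 (rexp (-u)) = rexp (u / 2) * evenKernel 0 (rexp u) := by
  rw [evenKernel_functional_equation 0 (rexp (-u)), ← evenKernel_eq_cosKernel_of_zero]
  congr 1
  · rw [← Real.exp_mul, one_div, ← Real.exp_neg]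
    congr 1; ring
  · rw [one_div, ← Real.exp_neg, neg_neg]

/-- `riemannIntegrand x = θ(x) - 1 - x^{-1/2}`, whose Mellin transform at `s/2` is `2 Λ(s)` on the
critical strip. [folklore] -/
def riemannIntegrand (x : ℝ) : ℂ := ((evenKernel 0 x : ℝ) : ℂ) - 1 - ((x ^ (-(1 / 2 : ℝ)) : ℝ) : ℂ)

/-- Mathlib's weak FE-pair for the Riemann zeta function. [folklore] -/
abbrev zetaPair : WeakFEPair ℂ := hurwitzEvenFEPair 0

/-- The `f` of Mathlib's zeta FE-pair is `evenKernel 0`. [folklore] -/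
lemma zetaPair_f (x : ℝ) : zetaPair.f x = (evenKernel 0 x : ℂ) := rfl
/-- The constant term `f₀ = 1` of Mathlib's zeta FE-pair. [folklore] -/
lemma zetaPair_f₀ : zetaPair.f₀ = 1 := if_pos rfl
/-- The constant term `g₀ = 1` of Mathlib's zeta FE-pair. [folklore] -/
lemma zetaPair_g₀ : zetaPair.g₀ = 1 := rfl
/-- The root number `ε = 1` of Mathlib's zeta FE-pair. [folklore] -/
lemma zetaPair_ε : zetaPair.ε = 1 := rfl
/-- The weight `k = 1/2` of Mathlib's zeta FE-pair. [folklore] -/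
lemma zetaPair_k : zetaPair.k = 1 / 2 := rfl

/-- Mathlib's modified kernel `f_modif` is `θ(x) - 1` for `x > 1`. [folklore] -/
lemma zetaPair_f_modif_of_one_lt {x : ℝ} (hx : 1 < x) :
    zetaPair.f_modif x = (evenKernel 0 x : ℂ) - 1 := by
  rw [WeakFEPair.f_modif, Pi.add_apply, indicator_of_mem (mem_Ioi.mpr hx),
    indicator_of_notMem (fun h ↦ by simp at h; linarith [h.2]), add_zero, zetaPair_f, zetaPair_f₀]

/-- Mathlib's modified kernel `f_modif` is `θ(x) - x^{-1/2}` for `0 < x < 1`. [folklore] -/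
lemma zetaPair_f_modif_of_lt_one {x : ℝ} (hx : 0 < x) (hx' : x < 1) :
    zetaPair.f_modif x = (evenKernel 0 x : ℂ) - ((x ^ (-(1 / 2 : ℝ)) : ℝ) : ℂ) := by
  rw [WeakFEPair.f_modif, Pi.add_apply, indicator_of_notMem (fun h ↦ by simp at h; linarith),
    indicator_of_mem (mem_Ioo.mpr ⟨hx, hx'⟩), zero_add, zetaPair_f, zetaPair_ε, zetaPair_k,
    zetaPair_g₀]
  simp

/-- The correction term `mellinCorrection = f_modif - riemannIntegrand`: equal to `1` on `(0,1)`
and to `x^{-1/2}` on `(1, ∞)`. [folklore] -/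
def mellinCorrection (x : ℝ) : ℂ := zetaPair.f_modif x - riemannIntegrand x

/-- The correction term is `1` on `(0, 1)`. [folklore] -/
lemma mellinCorrection_of_lt_one {x : ℝ} (hx : 0 < x) (hx' : x < 1) : mellinCorrection x = 1 := by
  rw [mellinCorrection, zetaPair_f_modif_of_lt_one hx hx', riemannIntegrand]; ring

/-- The correction term is `x^{-1/2}` on `(1, ∞)`. [folklore] -/
lemma mellinCorrection_of_one_lt {x : ℝ} (hx : 1 < x) :
    mellinCorrection x = (x : ℂ) ^ (-(1 / 2 : ℂ)) := by
  rw [mellinCorrection, zetaPair_f_modif_of_one_lt hx, riemannIntegrand, ofReal_cpow (by linarith)]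
  push_cast
  ring

/-- The Mellin transform of the correction term on `0 < re s < 1/2`. [folklore] -/
lemma hasMellin_mellinCorrection {s : ℂ} (hs0 : 0 < s.re) (hs1 : s.re < 1 / 2) :
    HasMellin mellinCorrection s (1 / s + 1 / (1 / 2 - s)) := by
  have hr1 : -1 < (s - 1).re := by simp; linarith
  have hr2 : (s - 1 + -(1 / 2 : ℂ)).re < -1 := by simp; linarith
  -- piece on `Ioc 0 1`
  have hI1 : IntegrableOn (fun t : ℝ ↦ (t : ℂ) ^ (s - 1)) (Ioc 0 1) :=
    (intervalIntegrable_iff_integrableOn_Ioc_of_le zero_le_one).mp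
      (intervalIntegral.intervalIntegrable_cpow' hr1)
  have hcongr1 : EqOn (fun t : ℝ ↦ (t : ℂ) ^ (s - 1) • mellinCorrection t)
      (fun t : ℝ ↦ (t : ℂ) ^ (s - 1)) (Ioo 0 1) := fun t ht ↦ by
    simp [mellinCorrection_of_lt_one ht.1 ht.2]
  have hI1' : IntegrableOn (fun t : ℝ ↦ (t : ℂ) ^ (s - 1) • mellinCorrection t) (Ioc 0 1) := by
    rw [integrableOn_Ioc_iff_integrableOn_Ioo] at hI1 ⊢
    exact hI1.congr_fun hcongr1.symm measurableSet_Ioo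
  have hint1 : ∫ t : ℝ in Ioc 0 1, (t : ℂ) ^ (s - 1) • mellinCorrection t = 1 / s := by
    rw [integral_Ioc_eq_integral_Ioo, setIntegral_congr_fun measurableSet_Ioo hcongr1,
      ← integral_Ioc_eq_integral_Ioo, ← intervalIntegral.integral_of_le zero_le_one,
      integral_cpow (Or.inl hr1)]
    have hs : s ≠ 0 := fun h ↦ by simp [h] at hs0
    simp [sub_add_cancel, zero_cpow hs]
  -- piece on `Ioi 1`
  have hcongr2 : EqOn (fun t : ℝ ↦ (t : ℂ) ^ (s - 1) • mellinCorrection t)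
      (fun t : ℝ ↦ (t : ℂ) ^ (s - 1 + -(1 / 2 : ℂ))) (Ioi 1) := fun t ht ↦ by
    have ht' : (t : ℂ) ≠ 0 := ofReal_ne_zero.mpr (by linarith [mem_Ioi.mp ht])
    simp [mellinCorrection_of_one_lt (mem_Ioi.mp ht), cpow_add _ _ ht']
  have hI2 : IntegrableOn (fun t : ℝ ↦ (t : ℂ) ^ (s - 1) • mellinCorrection t) (Ioi 1) :=
    (integrableOn_Ioi_cpow_of_lt hr2 zero_lt_one).congr_fun hcongr2.symm measurableSet_Ioi
  have hint2 : ∫ t : ℝ in Ioi 1, (t : ℂ) ^ (s - 1) • mellinCorrection t = 1 / (1 / 2 - s) := by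
    rw [setIntegral_congr_fun measurableSet_Ioi hcongr2, integral_Ioi_cpow_of_lt hr2 zero_lt_one]
    have : s - 1 + -(1 / 2 : ℂ) + 1 = -(1 / 2 - s) := by ring
    rw [this, ofReal_one, one_cpow, neg_div_neg_eq]
  refine ⟨?_, ?_⟩
  · rw [MellinConvergent, ← Ioc_union_Ioi_eq_Ioi zero_le_one]
    exact hI1'.union hI2
  · rw [mellin, ← Ioc_union_Ioi_eq_Ioi zero_le_one,
      setIntegral_union (Ioc_disjoint_Ioi le_rfl) measurableSet_Ioi hI1' hI2, hint1, hint2]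

/-- **Riemann's integral representation on the critical strip**:
`Λ(s) = ½ ∫₀^∞ (θ(x) - 1 - x^{-1/2}) x^{s/2 - 1} dx` for `0 < re s < 1`.
[cite: Titchmarsh1986, §2.6 (2.6.2)–(2.6.4)] -/
theorem completedRiemannZeta_eq_mellin_riemannIntegrand {s : ℂ} (hs0 : 0 < s.re) (hs1 : s.re < 1) :
    completedRiemannZeta s = mellin riemannIntegrand (s / 2) / 2 := by
  have hs'0 : 0 < (s / 2).re := by simp; linarith
  have hs'1 : (s / 2).re < 1 / 2 := by simp; linarith
  have hfm : MellinConvergent zetaPair.f_modif (s / 2) :=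
    (zetaPair.isStrongFEPair_toStrongFEPair.hasMellin (s / 2)).1
  obtain ⟨hgc, hgm⟩ := hasMellin_mellinCorrection hs'0 hs'1
  have hF := hasMellin_sub hfm hgc
  have hFeq : (fun t ↦ zetaPair.f_modif t - mellinCorrection t) = riemannIntegrand := by
    funext t; simp [mellinCorrection]
  rw [hFeq, hgm] at hF
  have h0 : completedRiemannZeta₀ s = mellin zetaPair.f_modif (s / 2) / 2 := rfl
  rw [completedRiemannZeta_eq, h0, hF.2]
  have hs : s ≠ 0 := fun h ↦ by simp [h] at hs0
  have hs' : 1 - s ≠ 0 := fun h ↦ by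
    have : s = 1 := by linear_combination -h
    simp [this] at hs1
  have hs'' : 1 / 2 - s / 2 ≠ 0 := fun h ↦ by
    have : s = 1 := by linear_combination -2 * h
    simp [this] at hs1
  field_simp
  ring

/-- The real restriction of Hardy's kernel. [folklore] -/
def hardyKernelReal (x : ℝ) : ℂ := hardyKernel x

/-- Real form of Hardy's kernel: `Φ(u) = e^{u/4} θ(e^u) - e^{u/4} - e^{-u/4}` with `θ = evenKernel
0`. [folklore] -/
lemma hardyKernelReal_eq (u : ℝ) :
    hardyKernelReal u =
      rexp (u / 4) * evenKernel 0 (rexp u) - (rexp (u / 4) + rexp (-(u / 4))) := by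
  rw [hardyKernelReal, hardyKernel, hardyTheta, ← Complex.ofReal_exp, thetaI_ofReal]
  push_cast
  ring_nf

/-- **Integral representation on the critical line**: `Λ(1/2 + it) = ½ 𝓕hardyKernelReal (t / 4π)`.
[cite: Titchmarsh1986, §2.16 (2.16.1)–(2.16.2)] -/
theorem completedRiemannZeta_critical_line (t : ℝ) :
    completedRiemannZeta (1 / 2 + t * I) = 𝓕 hardyKernelReal (t / (4 * π)) / 2 := by
  rw [completedRiemannZeta_eq_mellin_riemannIntegrand (by simp) (by simp; norm_num),
    mellin_eq_fourier]
  have hfun : (fun u : ℝ ↦ rexp (-((1 / 2 + ↑t * I) / 2).re * u) • riemannIntegrand (rexp (-u)))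
      = hardyKernelReal := by
    funext u
    rw [show -((1 / 2 + ↑t * I) / 2).re = -(1 / 4 : ℝ) by simp; norm_num]
    rw [riemannIntegrand, hardyKernelReal_eq, evenKernel_exp_neg, Complex.real_smul]
    have h1 : rexp (-u) ^ (-(1 / 2 : ℝ)) = rexp (u / 2) := by
      rw [← Real.exp_mul]; congr 1; ring
    rw [h1]
    push_cast
    have h2 : cexp (-(1 / 4) * u) * cexp (u / 2) = cexp (u / 4) := by
      rw [← Complex.exp_add]; congr 1; ring
    have h3 : cexp (-(1 / 4) * (u : ℂ)) = cexp (-(u / 4)) := by congr 1; ring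
    calc cexp (-(1 / 4) * u) * (cexp (u / 2) * (evenKernel 0 (rexp u) : ℂ) - 1 - cexp (u / 2))
        = cexp (-(1 / 4) * u) * cexp (u / 2) * (evenKernel 0 (rexp u) : ℂ)
          - cexp (-(1 / 4) * u) - cexp (-(1 / 4) * u) * cexp (u / 2) := by ring
      _ = _ := by rw [h2, h3]; ring
  have hpt : ((1 / 2 + ↑t * I) / 2).im / (2 * π) = t / (4 * π) := by
    simp; ring
  rw [hfun, hpt]


/-! ### Integrability of `hardyKernel` on horizontal lines; properties of `𝓕 hardyKernelReal` -/

/-- `e^{-|x|/4}` is integrable on `ℝ`. [folklore] -/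
lemma integrable_exp_neg_abs_div_four : Integrable (fun x : ℝ ↦ rexp (-(|x| / 4))) := by
  have h1 : IntegrableOn (fun x : ℝ ↦ rexp (-(|x| / 4))) (Ioi 0) := by
    refine (integrableOn_exp_mul_Ioi (a := -(1 / 4)) (by norm_num) 0).congr_fun
      (fun x hx ↦ ?_) measurableSet_Ioi
    rw [abs_of_pos (mem_Ioi.mp hx)]; ring_nf
  have h2 : IntegrableOn (fun x : ℝ ↦ rexp (-(|x| / 4))) (Iic 0) := by
    refine (integrableOn_exp_mul_Iic (a := (1 / 4)) (by norm_num) 0).congr_fun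
      (fun x hx ↦ ?_) measurableSet_Iic
    rw [abs_of_nonpos (mem_Iic.mp hx)]; ring_nf
  have := h2.union h1
  rwa [Iic_union_Ioi, integrableOn_univ] at this

/-- Hardy's kernel is continuous along every horizontal line `im = y`, `|y| < π/2`. [folklore] -/
lemma continuous_hardyKernel_horizontal {y : ℝ} (hy : |y| < π / 2) :
    Continuous (fun x : ℝ ↦ hardyKernel (x + y * I)) := by
  refine continuous_iff_continuousAt.mpr fun x ↦ ?_
  have h1 : ContinuousAt (fun x : ℝ ↦ (x : ℂ) + y * I) x := Continuous.continuousAt (by fun_prop)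
  exact (continuousAt_hardyKernel (u := x + y * I) (by simpa using hy)).comp
    (f := fun x : ℝ ↦ (x : ℂ) + y * I) h1

/-- Hardy's kernel is integrable along every horizontal line `im = y`, `|y| < π/2`. [folklore] -/
lemma integrable_hardyKernel_horizontal {y : ℝ} (hy : |y| < π / 2) :
    Integrable (fun x : ℝ ↦ hardyKernel (x + y * I)) := by
  obtain ⟨M, hM, h⟩ := norm_hardyKernel_le (abs_nonneg y) hy
  refine (integrable_exp_neg_abs_div_four.const_mul M).mono'
    (continuous_hardyKernel_horizontal hy).aestronglyMeasurable ?_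
  filter_upwards with x
  simpa using h (x + y * I) (by simp)

/-- Unfolding lemma for `hardyKernelReal`. [folklore] -/
lemma hardyKernelReal_def : hardyKernelReal = fun x : ℝ ↦ hardyKernel x := rfl

/-- The real restriction of Hardy's kernel is continuous. [folklore] -/
lemma continuous_hardyKernelReal : Continuous hardyKernelReal := by
  have := continuous_hardyKernel_horizontal (y := 0) (by simpa using pi_pos)
  rw [hardyKernelReal_def]
  simpa using this

/-- The real restriction of Hardy's kernel is integrable. [folklore] -/
lemma integrable_hardyKernelReal : Integrable hardyKernelReal := by
  have := integrable_hardyKernel_horizontal (y := 0) (by simpa using pi_pos)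
  rw [hardyKernelReal_def]
  simpa using this

/-- The real restriction of Hardy's kernel is even. [folklore] -/
lemma hardyKernelReal_neg (x : ℝ) : hardyKernelReal (-x) = hardyKernelReal x := by
  simp only [hardyKernelReal, ofReal_neg]
  exact hardyKernel_neg (by simpa using pi_pos)

/-- The real restriction of Hardy's kernel is real-valued. [folklore] -/
lemma conj_hardyKernelReal (x : ℝ) : conj (hardyKernelReal x) = hardyKernelReal x := by
  rw [hardyKernelReal, hardyKernel_conj, conj_ofReal]

/-- The Fourier transform of Hardy's kernel is continuous. [folklore] -/
lemma continuous_fourier_hardyKernelReal : Continuous (𝓕 hardyKernelReal) :=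
  VectorFourier.fourierIntegral_continuous Real.continuous_fourierChar continuous_inner
    integrable_hardyKernelReal

/-- The Fourier transform of Hardy's kernel is bounded by the `L¹` norm of the kernel. [folklore] -/
lemma norm_fourier_hardyKernelReal_le (ξ : ℝ) : ‖𝓕 hardyKernelReal ξ‖ ≤ ∫ x, ‖hardyKernelReal x‖ :=
  VectorFourier.norm_fourierIntegral_le_integral_norm _ _ _ _ _

/-- `𝓕 hardyKernelReal` is even. [folklore] -/
lemma fourier_hardyKernelReal_neg (ξ : ℝ) : 𝓕 hardyKernelReal (-ξ) = 𝓕 hardyKernelReal ξ := by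
  rw [← Real.fourierInv_eq_fourier_neg, Real.fourierInv_eq_fourier_comp_neg]
  have : (fun x ↦ hardyKernelReal (-x)) = hardyKernelReal := funext hardyKernelReal_neg
  rw [this]

/-- `𝓕 hardyKernelReal` is real-valued. [folklore] -/
lemma conj_fourier_hardyKernelReal (ξ : ℝ) : conj (𝓕 hardyKernelReal ξ) = 𝓕 hardyKernelReal ξ := by
  conv_rhs => rw [← fourier_hardyKernelReal_neg]
  rw [Real.fourier_real_eq_integral_exp_smul, Real.fourier_real_eq_integral_exp_smul,
    ← integral_conj]
  congr 1
  funext v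
  rw [smul_eq_mul, smul_eq_mul, map_mul, conj_hardyKernelReal, ← Complex.exp_conj, map_mul, conj_I,
    conj_ofReal]
  congr 2
  push_cast
  ring

/-- The Fourier transform of Hardy's kernel has vanishing imaginary part. [folklore] -/
lemma fourier_hardyKernelReal_im (ξ : ℝ) : (𝓕 hardyKernelReal ξ).im = 0 :=
  conj_eq_iff_im.mp (conj_fourier_hardyKernelReal ξ)

/-- The Fourier transform of Hardy's kernel equals (the cast of) its real part. [folklore] -/
lemma fourier_hardyKernelReal_eq_re (ξ : ℝ) :
    𝓕 hardyKernelReal ξ = ((𝓕 hardyKernelReal ξ).re : ℂ) :=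
  (conj_eq_iff_re.mp (conj_fourier_hardyKernelReal ξ)).symm

/-! ### Shifting the line of integration -/

/-- Multiplication formula for the Fourier transform on `ℝ`. [folklore] -/
lemma integral_fourier_mul_eq {f g : ℝ → ℂ} (hf : Integrable f) (hg : Integrable g) :
    ∫ ξ, 𝓕 f ξ * g ξ = ∫ x, f x * 𝓕 g x := by
  have := VectorFourier.integral_fourierIntegral_smul_eq_flip (L := innerₗ ℝ) (μ := volume)
    (ν := volume) Real.continuous_fourierChar continuous_inner hf hg
  rw [flip_innerₗ] at this
  exact this

/-- Shifting the line of integration of an analytic function across a horizontal strip.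
[folklore] -/
lemma integral_eq_integral_add_mul_I (f : ℂ → ℂ) (y : ℝ)
    (hd : DifferentiableOn ℂ f (univ ×ℂ [[0, y]]))
    (h0 : Integrable (fun x : ℝ ↦ f x)) (h1 : Integrable (fun x : ℝ ↦ f (x + y * I)))
    (hdecay : ∀ ε > 0, ∃ R₀, ∀ R s : ℝ, R₀ ≤ |R| → s ∈ [[0, y]] → ‖f (R + s * I)‖ ≤ ε) :
    ∫ x : ℝ, f x = ∫ x : ℝ, f (x + y * I) := by
  -- the difference of the truncated integrals
  set D : ℝ → ℂ := fun R ↦ (∫ x : ℝ in -R..R, f x) - ∫ x : ℝ in -R..R, f (x + y * I) with hD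
  have hlim1 : Tendsto D atTop (𝓝 ((∫ x : ℝ, f x) - ∫ x : ℝ, f (x + y * I))) := by
    apply Tendsto.sub
    · exact intervalIntegral_tendsto_integral h0 tendsto_neg_atTop_atBot tendsto_id
    · exact intervalIntegral_tendsto_integral h1 tendsto_neg_atTop_atBot tendsto_id
  have hlim2 : Tendsto D atTop (𝓝 0) := by
    rw [NormedAddGroup.tendsto_nhds_zero]
    intro ε hε
    obtain ⟨R₀, hR₀⟩ := hdecay (ε / (2 * (|y| + 1))) (by positivity)
    filter_upwards [eventually_ge_atTop R₀, eventually_ge_atTop 0] with R hR hRpos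
    have hrect := Complex.integral_boundary_rect_eq_zero_of_differentiableOn f (-(R : ℂ))
      (R + y * I)
      (hd.mono (by
        intro z hz
        exact ⟨mem_univ _, by simpa using hz.2⟩))
    simp only [ofReal_re, ofReal_im, add_re, mul_re, I_re, mul_zero, I_im, mul_one, sub_self,
      add_zero, add_im, mul_im, zero_add, ofReal_zero, zero_mul, neg_re, neg_im, neg_zero,
      ofReal_neg] at hrect
    have hDR : D R = -(I • ∫ s : ℝ in (0 : ℝ)..y, f (R + s * I))
        + I • ∫ s : ℝ in (0 : ℝ)..y, f (-R + s * I) := by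
      rw [hD]
      linear_combination hrect
    have hb1 : ‖∫ s : ℝ in (0 : ℝ)..y, f (R + s * I)‖ ≤ ε / (2 * (|y| + 1)) * |y - 0| := by
      refine intervalIntegral.norm_integral_le_of_norm_le_const fun s hs ↦ ?_
      exact hR₀ R s (by rw [abs_of_nonneg hRpos]; exact hR) (uIoc_subset_uIcc hs)
    have hb2 : ‖∫ s : ℝ in (0 : ℝ)..y, f (-R + s * I)‖ ≤ ε / (2 * (|y| + 1)) * |y - 0| := by
      refine intervalIntegral.norm_integral_le_of_norm_le_const fun s hs ↦ ?_
      have := hR₀ (-R) s (by rw [abs_neg, abs_of_nonneg hRpos]; exact hR) (uIoc_subset_uIcc hs)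
      simpa using this
    rw [sub_zero] at hb1 hb2
    calc ‖D R‖ ≤ ‖-(I • ∫ s : ℝ in (0 : ℝ)..y, f (R + s * I))‖
          + ‖I • ∫ s : ℝ in (0 : ℝ)..y, f (-R + s * I)‖ := by rw [hDR]; exact norm_add_le _ _
      _ ≤ ε / (2 * (|y| + 1)) * |y| + ε / (2 * (|y| + 1)) * |y| := by
          rw [norm_neg, norm_smul, norm_smul, norm_I, one_mul, one_mul]
          exact add_le_add hb1 hb2
      _ = ε * (|y| / (|y| + 1)) := by field_simp; ring
      _ < ε := by
          rw [mul_lt_iff_lt_one_right hε, div_lt_one (by positivity)]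
          linarith
  have := tendsto_nhds_unique hlim1 hlim2
  exact sub_eq_zero.mp this


/-! ### The key limit: testing `𝓕 hardyKernelReal` against exponentially tilted Gaussians -/

/-- The tilted Gaussian test function `ξ ↦ exp(-ξ²/C + 2π y ξ)`. [folklore] -/
def tiltedGaussian (C y : ℝ) (ξ : ℝ) : ℂ := cexp (-(1 / (C : ℂ)) * (ξ : ℂ) ^ 2 + 2 * π * y * ξ)

/-- The Gaussian kernel `K_C(w) = (π C)^{1/2} exp(-π² C w²)` (an approximate identity as
`C → ∞`). [folklore] -/
def gaussKernel (C : ℝ) (w : ℂ) : ℂ := (π * C : ℂ) ^ (1 / 2 : ℂ) * cexp (-(π ^ 2 * C : ℂ) * w ^ 2)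

/-- The tilted Gaussian is integrable. [folklore] -/
lemma integrable_tiltedGaussian {C : ℝ} (hC : 0 < C) (y : ℝ) : Integrable (tiltedGaussian C y) := by
  have hb : (-(1 / (C : ℂ))).re < 0 := by
    simp only [neg_re, one_div, inv_re, ofReal_re, Complex.normSq_ofReal]
    have : 0 < C / (C * C) := by positivity
    linarith
  have : tiltedGaussian C y =
      fun x : ℝ ↦ cexp (-(1 / (C : ℂ)) * (x : ℂ) ^ 2 + 2 * π * y * x + 0) := by
    funext x; rw [tiltedGaussian, add_zero]
  rw [this]
  exact integrable_cexp_quadratic' hb _ _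

/-- The norm of the tilted Gaussian. [folklore] -/
lemma norm_tiltedGaussian (C y ξ : ℝ) :
    ‖tiltedGaussian C y ξ‖ = rexp (-(1 / C) * ξ ^ 2 + 2 * π * y * ξ) := by
  rw [tiltedGaussian, Complex.norm_exp]
  congr 1
  have : -(1 / (C : ℂ)) * (ξ : ℂ) ^ 2 + 2 * π * y * ξ =
      ((-(1 / C) * ξ ^ 2 + 2 * π * y * ξ : ℝ) : ℂ) := by
    push_cast; ring
  rw [this, ofReal_re]

/-- The tilted Gaussian is real and positive. [folklore] -/
lemma tiltedGaussian_eq_ofReal (C y ξ : ℝ) :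
    tiltedGaussian C y ξ = (rexp (-(1 / C) * ξ ^ 2 + 2 * π * y * ξ) : ℂ) := by
  rw [tiltedGaussian, Complex.ofReal_exp]
  congr 1
  push_cast; ring

/-- Fourier transform of the tilted Gaussian. [folklore] -/
lemma fourier_tiltedGaussian {C : ℝ} (hC : 0 < C) (y : ℝ) :
    𝓕 (tiltedGaussian C y) = fun u : ℝ ↦ gaussKernel C (u + y * I) := by
  have hπC : (0 : ℝ) < π * C := by positivity
  have hb : 0 < ((π * C : ℂ)⁻¹).re := by
    have : ((π * C : ℂ)⁻¹) = ((π * C)⁻¹ : ℝ) := by push_cast; ring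
    rw [this, ofReal_re]; positivity
  have hG : tiltedGaussian C y = fun x : ℝ ↦ cexp (-π * (π * C : ℂ)⁻¹ * x ^ 2 + 2 * π * y * x) := by
    funext x
    simp only [tiltedGaussian]
    congr 1
    have hπ : (π : ℂ) ≠ 0 := ofReal_ne_zero.mpr pi_ne_zero
    have hC' : (C : ℂ) ≠ 0 := ofReal_ne_zero.mpr hC.ne'
    field_simp
  rw [hG, fourier_gaussian_pi' hb]
  funext u
  have harg : (π * C : ℂ).arg ≠ π := by
    have : (π * C : ℂ) = ((π * C : ℝ) : ℂ) := by push_cast; ring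
    rw [this, Complex.arg_ofReal_of_nonneg hπC.le]
    exact pi_ne_zero.symm
  have h1 : 1 / ((π * C : ℂ)⁻¹) ^ (1 / 2 : ℂ) = (π * C : ℂ) ^ (1 / 2 : ℂ) := by
    rw [Complex.inv_cpow _ _ harg, one_div, inv_inv]
  have h2 : -(π : ℂ) / (π * C : ℂ)⁻¹ * (u + I * y) ^ 2 = -(π ^ 2 * C : ℂ) * (u + y * I) ^ 2 := by
    have hπ : (π : ℂ) ≠ 0 := ofReal_ne_zero.mpr pi_ne_zero
    have hC' : (C : ℂ) ≠ 0 := ofReal_ne_zero.mpr hC.ne'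
    field_simp
  simp only [h1, h2, gaussKernel]

/-- Bound for the Gaussian kernel on horizontal lines: `‖K_C(w)‖ ≤ ‖(πC)^{1/2}‖ e^{π² C (im w)²}`.
[folklore] -/
lemma norm_gaussKernel_le {C : ℝ} (hC : 0 < C) (w : ℂ) :
    ‖gaussKernel C w‖ ≤ ‖(π * C : ℂ) ^ (1 / 2 : ℂ)‖ * rexp (π ^ 2 * C * w.im ^ 2) := by
  rw [gaussKernel, norm_mul, Complex.norm_exp]
  gcongr
  have : (-(π ^ 2 * C : ℂ) * w ^ 2).re = -(π ^ 2 * C) * (w.re ^ 2 - w.im ^ 2) := by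
    have h1 : (-(π ^ 2 * C : ℂ) * w ^ 2) = ((-(π ^ 2 * C) : ℝ) : ℂ) * w ^ 2 := by push_cast; ring
    rw [h1, re_ofReal_mul]
    simp [sq, mul_re]
  rw [this]
  have : 0 ≤ π ^ 2 * C * w.re ^ 2 := by positivity
  nlinarith

/-- The Gaussian kernel is bounded by `‖(πC)^{1/2}‖` on the real line. [folklore] -/
lemma norm_gaussKernel_ofReal_le {C : ℝ} (hC : 0 < C) (x : ℝ) :
    ‖gaussKernel C x‖ ≤ ‖(π * C : ℂ) ^ (1 / 2 : ℂ)‖ := by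
  simpa using norm_gaussKernel_le hC x

/-- The Gaussian kernel is entire. [folklore] -/
lemma differentiable_gaussKernel (C : ℝ) : Differentiable ℂ (gaussKernel C) := by
  unfold gaussKernel; fun_prop

/-- The Gaussian kernel is continuous. [folklore] -/
lemma continuous_gaussKernel (C : ℝ) : Continuous (gaussKernel C) :=
  (differentiable_gaussKernel C).continuous

/-- **Key identity**: testing `𝓕 hardyKernelReal` against the tilted Gaussian probes `hardyKernel`
on the line `im = -y`, through the Gaussian approximate identity `K_C`. [folklore] -/
theorem integral_fourier_hardyKernelReal_mul_tiltedGaussian {y : ℝ} (hy : |y| < π / 2) {C : ℝ}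
    (hC : 0 < C) :
    ∫ ξ : ℝ, 𝓕 hardyKernelReal ξ * tiltedGaussian C y ξ =
      ∫ x : ℝ, gaussKernel C x * hardyKernel (x + ((-y : ℝ) : ℂ) * I) := by
  rw [integral_fourier_mul_eq integrable_hardyKernelReal (integrable_tiltedGaussian hC y),
    fourier_tiltedGaussian hC y]
  set H : ℂ → ℂ := fun w ↦ gaussKernel C (w + y * I) * hardyKernel w with hH
  have hy' : |(-y)| < π / 2 := by simpa using hy
  obtain ⟨M, hM, hMb⟩ := norm_hardyKernel_le (abs_nonneg y) hy
  set K₀ : ℝ := ‖(π * C : ℂ) ^ (1 / 2 : ℂ)‖ * rexp (π ^ 2 * C * (2 * |y|) ^ 2) with hK₀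
  have hK₀pos : 0 ≤ K₀ := by positivity
  -- `H` restricted to the real line and to the line `im = -y`
  have e1 : (fun x : ℝ ↦ hardyKernelReal x * gaussKernel C (x + y * I)) = fun x : ℝ ↦ H x := by
    funext x; simp only [hH, hardyKernelReal]; ring
  have e2 : (fun x : ℝ ↦ H (x + ((-y : ℝ) : ℂ) * I)) =
      fun x : ℝ ↦ gaussKernel C x * hardyKernel (x + ((-y : ℝ) : ℂ) * I) := by
    funext x; simp only [hH]; congr 2; push_cast; ring
  -- differentiability on the strip
  have hd : DifferentiableOn ℂ H (univ ×ℂ [[0, -y]]) := by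
    intro w hw
    have hwim : |w.im| < π / 2 := by
      have := abs_sub_left_of_mem_uIcc hw.2
      simp only [sub_zero] at this
      exact lt_of_le_of_lt (by simpa using this) hy
    exact (((differentiable_gaussKernel C).differentiableAt.comp w
      (differentiableAt_id.add_const _)).mul
        (differentiableAt_hardyKernel hwim)).differentiableWithinAt
  -- integrability on `ℝ`
  have h0 : Integrable (fun x : ℝ ↦ H x) := by
    rw [← e1]
    simp_rw [mul_comm (hardyKernelReal _)]
    refine integrable_hardyKernelReal.bdd_mul (c := K₀) ?_ ?_
    · exact ((continuous_gaussKernel C).comp (by fun_prop)).aestronglyMeasurable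
    · filter_upwards with x
      refine (norm_gaussKernel_le hC _).trans ?_
      simp only [hK₀]
      refine mul_le_mul_of_nonneg_left (Real.exp_le_exp.mpr ?_) (norm_nonneg _)
      refine mul_le_mul_of_nonneg_left (sq_le_sq.mpr ?_) (by positivity)
      rw [abs_of_nonneg (by positivity : (0 : ℝ) ≤ 2 * |y|)]
      simp only [add_im, ofReal_im, mul_im, ofReal_re, I_im, mul_one, I_re, mul_zero, add_zero,
        zero_add]
      linarith [abs_nonneg y]
  -- integrability on `im = -y`
  have h1 : Integrable (fun x : ℝ ↦ H (x + ((-y : ℝ) : ℂ) * I)) := by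
    rw [e2]
    refine (integrable_hardyKernel_horizontal hy').bdd_mul (c := ‖(π * C : ℂ) ^ (1 / 2 : ℂ)‖) ?_ ?_
    · exact ((continuous_gaussKernel C).comp continuous_ofReal).aestronglyMeasurable
    · filter_upwards with x using norm_gaussKernel_ofReal_le hC x
  -- uniform decay at the vertical edges
  have hdecay : ∀ ε > 0, ∃ R₀, ∀ R s : ℝ, R₀ ≤ |R| → s ∈ [[0, -y]] → ‖H (R + s * I)‖ ≤ ε := by
    intro ε hε
    obtain ⟨R₁, hR₁⟩ := (Real.tendsto_exp_neg_atTop_nhds_zero.eventually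
      (gt_mem_nhds (show (0 : ℝ) < ε / (M * K₀ + 1) by positivity))).exists_forall_of_atTop
    refine ⟨4 * max R₁ 0, fun R s hR hs ↦ ?_⟩
    have hsy : |s| ≤ |y| := by
      have := abs_sub_left_of_mem_uIcc hs
      simpa using this
    have h1 : ‖hardyKernel (R + s * I)‖ ≤ M * rexp (-(|R| / 4)) := by
      simpa using hMb (R + s * I) (by simpa using hsy)
    have h2 : ‖gaussKernel C (R + s * I + y * I)‖ ≤ K₀ := by
      refine (norm_gaussKernel_le hC _).trans ?_
      simp only [hK₀]
      refine mul_le_mul_of_nonneg_left (Real.exp_le_exp.mpr ?_) (norm_nonneg _)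
      refine mul_le_mul_of_nonneg_left (sq_le_sq.mpr ?_) (by positivity)
      simp only [add_im, ofReal_im, mul_im, ofReal_re, I_im, mul_one, I_re, mul_zero, add_zero,
        zero_add]
      rw [abs_of_nonneg (by positivity : (0 : ℝ) ≤ 2 * |y|)]
      calc |s + y| ≤ |s| + |y| := abs_add_le _ _
        _ ≤ 2 * |y| := by linarith
    have h3 : rexp (-(|R| / 4)) < ε / (M * K₀ + 1) := by
      have : rexp (-(|R| / 4)) ≤ rexp (-(max R₁ 0)) := Real.exp_le_exp.mpr (by linarith)
      refine lt_of_le_of_lt (this.trans ?_) (hR₁ (max R₁ 0) (le_max_left _ _))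
      simp
    calc ‖H (R + s * I)‖ = ‖gaussKernel C (R + s * I + y * I)‖ * ‖hardyKernel (R + s * I)‖ :=
          norm_mul _ _
      _ ≤ K₀ * (M * rexp (-(|R| / 4))) := by gcongr
      _ = (M * K₀) * rexp (-(|R| / 4)) := by ring
      _ ≤ (M * K₀ + 1) * rexp (-(|R| / 4)) := by gcongr; linarith
      _ ≤ (M * K₀ + 1) * (ε / (M * K₀ + 1)) := by gcongr
      _ = ε := by field_simp
  rw [e1, integral_eq_integral_add_mul_I H (-y) hd h0 h1 hdecay, e2]

/-- **Key limit**: `∫ 𝓕hardyKernelReal(ξ) e^{2π y ξ} e^{-ξ²/C} dξ → hardyKernel(iy)` as `C → ∞`,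
for `|y| < π/2`. [folklore] -/
theorem tendsto_integral_fourier_hardyKernelReal_mul_tiltedGaussian {y : ℝ} (hy : |y| < π / 2) :
    Tendsto (fun C : ℝ ↦ ∫ ξ : ℝ, 𝓕 hardyKernelReal ξ * tiltedGaussian C y ξ) atTop
      (𝓝 (hardyKernel (y * I))) := by
  have hy' : |(-y)| < π / 2 := by simpa using hy
  have hf : Integrable (fun x : ℝ ↦ hardyKernel (x + ((-y : ℝ) : ℂ) * I)) :=
    integrable_hardyKernel_horizontal hy'
  have hc : ContinuousAt (fun x : ℝ ↦ hardyKernel (x + ((-y : ℝ) : ℂ) * I)) 0 :=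
    (continuous_hardyKernel_horizontal hy').continuousAt
  have hlim : Tendsto (fun c : ℝ ↦ ∫ w : ℝ, ((π * c : ℂ) ^ ((Module.finrank ℝ ℝ : ℂ) / 2) *
      cexp (-π ^ 2 * c * (‖(0 : ℝ) - w‖ : ℂ) ^ 2)) • hardyKernel (w + ((-y : ℝ) : ℂ) * I)) atTop
      (𝓝 (hardyKernel ((0 : ℝ) + ((-y : ℝ) : ℂ) * I))) :=
    Real.tendsto_integral_gaussian_smul' hf hc
  have hval : hardyKernel ((0 : ℝ) + ((-y : ℝ) : ℂ) * I) = hardyKernel (y * I) := by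
    rw [ofReal_zero, zero_add, ofReal_neg, neg_mul]
    exact hardyKernel_neg (by simpa using lt_of_lt_of_le hy (by linarith [pi_pos]))
  rw [hval, Module.finrank_self, Nat.cast_one] at hlim
  refine hlim.congr' ?_
  filter_upwards [eventually_gt_atTop 0] with C hC
  rw [integral_fourier_hardyKernelReal_mul_tiltedGaussian hy hC]
  congr 1
  funext x
  have hx : ((‖(0 : ℝ) - x‖ : ℝ) : ℂ) ^ 2 = (x : ℂ) ^ 2 := by
    rw [show ‖(0 : ℝ) - x‖ = |x| by simp]
    norm_cast
    exact sq_abs x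
  rw [smul_eq_mul, gaussKernel, hx]
  congr 3
  ring


/-! ### Smallness of the theta part `hardyTheta (i y)` as `y ↑ π/2` -/

/-- Half-period shift of the two-variable theta function:
`θ(z, τ) = θ(z + 1/2, τ + 1)` (since `n² ≡ n (mod 2)`). [folklore] -/
lemma jacobiTheta₂_eq_add_half (z τ : ℂ) :
    jacobiTheta₂ z τ = jacobiTheta₂ (z + 1 / 2) (τ + 1) := by
  unfold jacobiTheta₂
  refine tsum_congr fun n ↦ ?_
  simp only [jacobiTheta₂_term]
  obtain ⟨k, hk⟩ := Int.even_mul_succ_self n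
  have hk' : ((n : ℂ) + n ^ 2) = 2 * k := by
    have : (n * (n + 1) : ℤ) = k + k := hk
    have h2 : ((n * (n + 1) : ℤ) : ℂ) = ((k + k : ℤ) : ℂ) := by rw [this]
    push_cast at h2
    linear_combination h2
  have : 2 * π * I * n * (z + 1 / 2) + π * I * n ^ 2 * (τ + 1)
      = (2 * π * I * n * z + π * I * n ^ 2 * τ) + k * (2 * π * I) := by
    linear_combination (π * I) * hk'
  simp only [this, Complex.exp_add, Complex.exp_int_mul_two_pi_mul_I, mul_one]

/-- `re (I / w) = im w / |w|²`. [folklore] -/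
lemma re_I_div (w : ℂ) : (I / w).re = w.im / normSq w := by
  rw [div_re]; simp

/-- The theta transformation formula bounding `thetaI` near the point `i` of the boundary of its
half-plane of convergence: for `w = τ + 1` in the upper half-plane,
`‖θ(0, τ)‖ ≤ ‖w‖^{-1/2} · θ_{1/2}(im w / |w|²)` where `θ_{1/2}(t) = ∑ₙ e^{-π (n+1/2)² t}`.
[cite: Titchmarsh1986, §10.2 (display after (10.2.1))] -/
lemma norm_jacobiTheta₂_le_of_near_neg_one {τ : ℂ} (hτ : 0 < (τ + 1).im) :
    ‖jacobiTheta₂ 0 τ‖ ≤ ‖τ + 1‖ ^ (-(1 / 2 : ℝ)) *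
      evenKernel ((1 / 2 : ℝ) : UnitAddCircle) ((τ + 1).im / normSq (τ + 1)) := by
  set w := τ + 1 with hw
  have hw0 : w ≠ 0 := fun h ↦ by simp [h] at hτ
  have hnsq : 0 < normSq w := normSq_pos.mpr hw0
  set T := w.im / normSq w with hT
  have hTpos : 0 < T := div_pos hτ hnsq
  rw [jacobiTheta₂_eq_add_half 0 τ, zero_add, ← hw, ← jacobiTheta₂_neg_left,
    jacobiTheta₂_functional_equation, mul_assoc, norm_mul]
  -- the prefactor
  have h1 : ‖1 / (-I * w) ^ (1 / 2 : ℂ)‖ = ‖w‖ ^ (-(1 / 2 : ℝ)) := by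
    rw [norm_div, norm_one, show (1 / 2 : ℂ) = ((1 / 2 : ℝ) : ℂ) by push_cast; ring,
      norm_cpow_real, norm_mul, norm_neg, norm_I, one_mul, Real.rpow_neg (norm_nonneg _),
      one_div]
  rw [h1]
  gcongr
  -- the series
  have hS := hasSum_int_evenKernel (1 / 2 : ℝ) hTpos
  have hterm : ∀ n : ℤ, cexp (-π * I * (-(1 / 2)) ^ 2 / w) *
      jacobiTheta₂_term n (-(1 / 2) / w) (-1 / w) =
      cexp (((-π * (n + 1 / 2) ^ 2 : ℝ) : ℂ) * (I / w)) := by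
    intro n
    rw [jacobiTheta₂_term, ← Complex.exp_add]
    congr 1
    push_cast
    field_simp
    ring
  have hnorm : ∀ n : ℤ, ‖cexp (((-π * (n + 1 / 2) ^ 2 : ℝ) : ℂ) * (I / w))‖ =
      rexp (-π * (n + 1 / 2) ^ 2 * T) := by
    intro n
    rw [Complex.norm_exp, re_ofReal_mul, re_I_div]
  rw [jacobiTheta₂, ← tsum_mul_left]
  simp_rw [hterm]
  refine (norm_tsum_le_tsum_norm ?_).trans ?_
  · simp_rw [hnorm]; exact hS.summable
  · simp_rw [hnorm]; exact hS.tsum_eq.le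

/-- Explicit bound for the theta part of Hardy's kernel on the imaginary axis:
for `0 ≤ y < π/2`, `‖hardyTheta(iy)‖ ≤ (cos y)^{-1/2} θ_{1/2}(cos y / (2 (1 - sin y)))`.
[cite: Titchmarsh1986, §10.2] -/
lemma norm_hardyTheta_mul_I_le {y : ℝ} (hy : y < π / 2) (hy' : -(π / 2) < y) :
    ‖hardyTheta (y * I)‖ ≤ (Real.cos y) ^ (-(1 / 2 : ℝ)) *
      evenKernel ((1 / 2 : ℝ) : UnitAddCircle) (Real.cos y / (2 * (1 - Real.sin y))) := by
  have hcos : 0 < Real.cos y := Real.cos_pos_of_mem_Ioo ⟨hy', hy⟩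
  have hsin : Real.sin y < 1 := by
    rw [← Real.sin_pi_div_two]
    exact Real.sin_lt_sin_of_lt_of_le_pi_div_two (by linarith) le_rfl hy
  set τ : ℂ := I * cexp (y * I) with hτ
  have hw : τ + 1 = ((1 - Real.sin y : ℝ) : ℂ) + (Real.cos y : ℝ) * I := by
    rw [hτ, Complex.exp_mul_I, ← Complex.ofReal_cos, ← Complex.ofReal_sin]
    push_cast
    ring_nf
    rw [I_sq]
    ring
  have hwim : (τ + 1).im = Real.cos y := by
    rw [hw]
    simp only [add_im, ofReal_im, mul_im, ofReal_re, I_im, I_re, mul_one, mul_zero, add_zero,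
      zero_add]
  have hwnsq : normSq (τ + 1) = 2 * (1 - Real.sin y) := by
    rw [hw, normSq_add_mul_I]
    nlinarith [Real.sin_sq_add_cos_sq y]
  have hwnorm : Real.cos y ≤ ‖τ + 1‖ := by
    have := abs_im_le_norm (τ + 1)
    rwa [hwim, abs_of_pos hcos] at this
  have hA : ‖hardyTheta (y * I)‖ = ‖jacobiTheta₂ 0 τ‖ := by
    rw [hardyTheta, norm_mul, Complex.norm_exp]
    have : ((y : ℂ) * I / 4).re = 0 := by simp
    rw [this, Real.exp_zero, one_mul, thetaI]
  rw [hA]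
  refine (norm_jacobiTheta₂_le_of_near_neg_one (by rw [hwim]; exact hcos)).trans ?_
  rw [hwim, hwnsq]
  have hT : 0 < Real.cos y / (2 * (1 - Real.sin y)) := by
    apply div_pos hcos; linarith
  refine mul_le_mul_of_nonneg_right ?_
    ((hasSum_int_evenKernel (1 / 2 : ℝ) hT).nonneg fun n ↦ (Real.exp_pos _).le)
  exact Real.rpow_le_rpow_of_nonpos hcos hwnorm (by norm_num)


/-- `1/2 ≠ 0` in `ℝ/ℤ`. [folklore] -/
lemma half_ne_zero_unitAddCircle : ((1 / 2 : ℝ) : UnitAddCircle) ≠ 0 := by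
  intro h
  obtain ⟨n, hn⟩ := (AddCircle.coe_eq_zero_iff 1).mp h
  simp at hn
  have : (2 * n : ℝ) = 1 := by rw [hn]; norm_num
  norm_cast at this
  omega

/-- **Boundary smallness.** The theta part `hardyTheta(iy)` of Hardy's kernel tends to zero faster
than any power of `π/2 - y` as `y ↑ π/2` (Titchmarsh §10.2: "`½ + ψ(x)` and all its
derivatives tend to zero as `x → i`"). Quantitative form used in the endgame.
[cite: Titchmarsh1986, §10.2] -/
lemma norm_hardyTheta_mul_I_small (N : ℕ) {ε : ℝ} (hε : 0 < ε) :
    ∃ δ₀ > 0, ∀ δ y : ℝ, 0 < δ → δ ≤ δ₀ → δ ≤ π / 2 - y → π / 2 - y ≤ 2 * δ →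
      ‖hardyTheta (y * I)‖ ≤ ε * δ ^ N := by
  set a : UnitAddCircle := ((1 / 2 : ℝ) : UnitAddCircle) with ha_def
  have ha : a ≠ 0 := half_ne_zero_unitAddCircle
  obtain ⟨p, hp, hO⟩ := isBigO_atTop_evenKernel_sub a
  simp only [ha, if_false, sub_zero] at hO
  obtain ⟨C₀, hC₀⟩ := hO.bound
  obtain ⟨T₀, hT₀⟩ := eventually_atTop.mp hC₀
  set C₁ := max C₀ 1 with hC₁
  have hC₁pos : 0 < C₁ := lt_of_lt_of_le one_pos (le_max_right _ _)
  -- the decay function `h(x) = x^{N+1} e^{-(p/π) x} → 0`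
  have hlim := tendsto_rpow_mul_exp_neg_mul_atTop_nhds_zero ((N : ℝ) + 1) (p / π)
    (div_pos hp pi_pos)
  set ε' := ε / (C₁ * π) with hε'
  have hε'pos : 0 < ε' := by positivity
  obtain ⟨x₀, hx₀⟩ := (hlim.eventually (gt_mem_nhds hε'pos)).exists_forall_of_atTop
  set x₁ := max x₀ (max T₀ 1) with hx₁
  have hx₁pos : 0 < x₁ := lt_of_lt_of_le one_pos ((le_max_right _ _).trans (le_max_right _ _))
  refine ⟨min (1 / (π * x₁)) (π / 8), by positivity, fun δ y hδ hδ₀ h1 h2 ↦ ?_⟩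
  have hδ1 : δ ≤ 1 / (π * x₁) := hδ₀.trans (min_le_left _ _)
  have hδ2 : δ ≤ π / 8 := hδ₀.trans (min_le_right _ _)
  -- the geometry of `y`
  set δ' := π / 2 - y with hδ'
  have hy_eq : y = π / 2 - δ' := by rw [hδ']; ring
  have hδ'pos : 0 < δ' := lt_of_lt_of_le hδ h1
  have hδ'le : δ' ≤ π / 2 := by linarith [pi_pos]
  have hcos : Real.cos y = Real.sin δ' := by rw [hy_eq, Real.cos_pi_div_two_sub]
  have hsin : Real.sin y = Real.cos δ' := by rw [hy_eq, Real.sin_pi_div_two_sub]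
  have hsinδ' : 2 / π * δ' ≤ Real.sin δ' := Real.mul_le_sin hδ'pos.le hδ'le
  have hcos_pos : 0 < Real.cos y := by
    rw [hcos]; exact lt_of_lt_of_le (by positivity) hsinδ'
  have hcos_le : Real.cos y ≤ 1 := Real.cos_le_one y
  have h1cos : 0 < 1 - Real.sin y := by
    rw [hsin]
    have : Real.cos δ' < 1 := by
      rw [← Real.cos_zero]
      exact Real.cos_lt_cos_of_nonneg_of_le_pi_div_two le_rfl hδ'le hδ'pos
    linarith
  have h1cos' : 1 - Real.sin y ≤ δ' ^ 2 / 2 := by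
    rw [hsin]; linarith [Real.one_sub_sq_div_two_le_cos (x := δ')]
  -- lower bound for `T`
  set T := Real.cos y / (2 * (1 - Real.sin y)) with hT
  have hTge : 1 / (π * δ) ≤ T := by
    rw [hT, div_le_div_iff₀ (by positivity) (by positivity), hcos]
    calc 1 * (2 * (1 - Real.sin y)) ≤ 2 * (δ' ^ 2 / 2) := by linarith
      _ = δ' * δ' := by ring
      _ ≤ δ' * (2 * δ) := by gcongr
      _ = (2 / π * δ') * (π * δ) := by field_simp
      _ ≤ Real.sin δ' * (π * δ) := by gcongr
  have hx₁δ : x₁ ≤ 1 / (π * δ) := by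
    rw [le_div_iff₀ (by positivity)]
    calc x₁ * (π * δ) ≤ x₁ * (π * (1 / (π * x₁))) := by gcongr
      _ = 1 := by field_simp
  have hTge' : T₀ ≤ T :=
    le_trans ((le_max_left _ _).trans ((le_max_right _ _).trans hx₁δ)) hTge
  -- bound for the theta factor
  have hθ : evenKernel a T ≤ C₁ * rexp (-(p / π) * (1 / δ)) := by
    have := hT₀ T hTge'
    rw [Real.norm_of_nonneg ((hasSum_int_evenKernel (1 / 2 : ℝ)
      (lt_of_lt_of_le (by positivity) hTge)).nonneg fun n ↦ (Real.exp_pos _).le),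
      Real.norm_of_nonneg (Real.exp_pos _).le] at this
    refine this.trans ?_
    have hexp : rexp (-p * T) ≤ rexp (-(p / π) * (1 / δ)) := by
      rw [Real.exp_le_exp]
      have : -(p / π) * (1 / δ) = -(p * (1 / (π * δ))) := by field_simp
      rw [this]
      nlinarith
    calc C₀ * rexp (-p * T) ≤ C₁ * rexp (-p * T) := by gcongr; exact le_max_left _ _
      _ ≤ C₁ * rexp (-(p / π) * (1 / δ)) := by gcongr
  -- bound for the prefactor
  have hpre : Real.cos y ^ (-(1 / 2 : ℝ)) ≤ π / (2 * δ) := by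
    calc Real.cos y ^ (-(1 / 2 : ℝ)) ≤ Real.cos y ^ (-(1 : ℝ)) :=
          Real.rpow_le_rpow_of_exponent_ge hcos_pos hcos_le (by norm_num)
      _ = (Real.cos y)⁻¹ := Real.rpow_neg_one _
      _ ≤ (2 / π * δ)⁻¹ := by
          rw [inv_le_inv₀ hcos_pos (by positivity), hcos]
          exact le_trans (by gcongr) hsinδ'
      _ = π / (2 * δ) := by field_simp
  -- the decay estimate at `x = 1/δ`
  have hxδ : x₀ ≤ 1 / δ := by
    have : x₁ ≤ 1 / δ := hx₁δ.trans (by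
      rw [div_le_div_iff₀ (by positivity) hδ]; nlinarith [pi_gt_three])
    exact (le_max_left _ _).trans this
  have hh := hx₀ (1 / δ) hxδ
  -- `(1/δ)^(N+1) * exp(-(p/π)/δ) < ε'`
  rw [Real.rpow_add_one (by positivity), Real.rpow_natCast] at hh
  have hh' : (1 / δ) * rexp (-(p / π) * (1 / δ)) ≤ ε' * δ ^ N := by
    have hδN : 0 < δ ^ N := pow_pos hδ N
    rw [one_div_pow, mul_assoc, div_mul_eq_mul_div, one_mul, div_lt_iff₀ hδN] at hh
    exact hh.le
  -- assemble
  calc ‖hardyTheta (y * I)‖ ≤ Real.cos y ^ (-(1 / 2 : ℝ)) * evenKernel a T :=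
        norm_hardyTheta_mul_I_le (by linarith) (by linarith [pi_pos])
    _ ≤ (π / (2 * δ)) * (C₁ * rexp (-(p / π) * (1 / δ))) := by
        gcongr
        exact (hasSum_int_evenKernel (1 / 2 : ℝ)
          (lt_of_lt_of_le (by positivity) hTge)).nonneg fun n ↦ (Real.exp_pos _).le
    _ = (C₁ * π / 2) * ((1 / δ) * rexp (-(p / π) * (1 / δ))) := by
        field_simp
    _ ≤ (C₁ * π / 2) * (ε' * δ ^ N) := by gcongr
    _ = (ε / 2) * δ ^ N := by rw [hε']; field_simp
    _ ≤ ε * δ ^ N := by gcongr; linarith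


/-! ### Endgame algebra: binomial weights and a trigonometric identity -/

/-- `∑ⱼ C(2n,j) (-1)^j e^{a + j b} = e^a (1 - e^b)^{2n}` (complex version). [folklore] -/
lemma sum_choose_cexp (n : ℕ) (a b : ℂ) :
    ∑ j ∈ Finset.range (2 * n + 1), ((2 * n).choose j : ℂ) * (-1) ^ j * cexp (a + j * b)
      = cexp a * (1 - cexp b) ^ (2 * n) := by
  rw [sub_eq_neg_add, add_pow, Finset.mul_sum]
  refine Finset.sum_congr rfl fun j _ ↦ ?_
  rw [Complex.exp_add, one_pow, mul_one, neg_pow, Complex.exp_nat_mul]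
  ring

/-- `∑ⱼ C(2n,j) (-1)^j e^{a + j b} = e^a (e^b - 1)^{2n}` (real version). [folklore] -/
lemma sum_choose_rexp (n : ℕ) (a b : ℝ) :
    ∑ j ∈ Finset.range (2 * n + 1), ((2 * n).choose j : ℝ) * (-1) ^ j * rexp (a + j * b)
      = rexp a * (rexp b - 1) ^ (2 * n) := by
  have : (rexp b - 1) ^ (2 * n) = (-rexp b + 1) ^ (2 * n) := by
    rw [← neg_sub, Even.neg_pow (even_two_mul n), sub_eq_neg_add]
  rw [this, add_pow, Finset.mul_sum]
  refine Finset.sum_congr rfl fun j _ ↦ ?_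
  rw [Real.exp_add, one_pow, mul_one, neg_pow, Real.exp_nat_mul]
  ring

/-- `(1 - e^{iθ})^{2n} = e^{inθ} (-4)^n sin^{2n}(θ/2)`. [folklore] -/
lemma one_sub_cexp_pow (n : ℕ) (θ : ℝ) :
    (1 - cexp (θ * I)) ^ (2 * n) =
      cexp (n * θ * I) * (-4) ^ n * ((Real.sin (θ / 2)) ^ (2 * n) : ℝ) := by
  have hsq : (1 - cexp (θ * I)) ^ 2 = cexp (θ * I) * (-4) * (Real.sin (θ / 2) : ℂ) ^ 2 := by
    set e := cexp ((θ / 2 : ℂ) * I) with he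
    have he0 : e ≠ 0 := Complex.exp_ne_zero _
    have hs : (Real.sin (θ / 2) : ℂ) = (e⁻¹ - e) * I / 2 := by
      rw [Complex.ofReal_sin, Complex.sin, he, ← Complex.exp_neg]
      push_cast
      ring_nf
    have h1 : cexp (θ * I) = e ^ 2 := by
      rw [he, sq, ← Complex.exp_add]; congr 1; ring
    have key : (e⁻¹ - e) * e = 1 - e ^ 2 := by field_simp
    have hI : ((e⁻¹ - e) * I / 2) ^ 2 = -((e⁻¹ - e) ^ 2) / 4 := by
      rw [div_pow, mul_pow, I_sq]; ring
    rw [hs, h1, hI, ← key]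
    ring
  rw [pow_mul, hsq, mul_pow, mul_pow, ← Complex.exp_nat_mul]
  push_cast
  rw [← pow_mul]
  congr 2; ring


/-- `e^{iy/4} + e^{-iy/4} = 2 cos (y/4)`. [folklore] -/
lemma cexp_add_cexp_neg (y : ℝ) :
    cexp ((y : ℂ) * I / 4) + cexp (-((y : ℂ) * I / 4)) = ((2 * Real.cos (y / 4) : ℝ) : ℂ) := by
  push_cast
  rw [Complex.two_cos]
  congr 2
  · ring
  · ring

/-- On the imaginary axis, `re Φ(iy) = re A(iy) - 2 cos(y/4)`. [folklore] -/
lemma re_hardyKernel_mul_I (y : ℝ) :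
    (hardyKernel (y * I)).re = (hardyTheta (y * I)).re - 2 * Real.cos (y / 4) := by
  rw [hardyKernel, sub_re, cexp_add_cexp_neg, ofReal_re]

/-- The trigonometric sum behind Hardy's sign argument:
`∑ⱼ C(2n,j)(-1)^j (e^{i yⱼ/4} + e^{-i yⱼ/4}) = (-4)^n sin^{2n}(k/8) · 2cos((y₀ + nk)/4)`,
where `yⱼ = y₀ + j k`. [folklore] -/
lemma sum_choose_cexp_cos (n : ℕ) (y₀ k : ℝ) :
    ∑ j ∈ Finset.range (2 * n + 1), ((2 * n).choose j : ℂ) * (-1) ^ j *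
        (cexp (((y₀ + j * k : ℝ) : ℂ) * I / 4) + cexp (-(((y₀ + j * k : ℝ) : ℂ) * I / 4)))
      = (-4 : ℂ) ^ n * ((Real.sin (k / 8) ^ (2 * n) : ℝ) : ℂ) *
        ((2 * Real.cos ((y₀ + n * k) / 4) : ℝ) : ℂ) := by
  have h1 : ∀ j : ℕ, cexp (((y₀ + j * k : ℝ) : ℂ) * I / 4)
      = cexp ((y₀ : ℂ) * I / 4 + j * ((k : ℂ) * I / 4)) := by
    intro j; congr 1; push_cast; ring
  have h1' : ∀ j : ℕ, cexp (-(((y₀ + j * k : ℝ) : ℂ) * I / 4))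
      = cexp (-((y₀ : ℂ) * I / 4) + j * (-((k : ℂ) * I / 4))) := by
    intro j; congr 1; push_cast; ring
  simp_rw [h1, h1', mul_add, Finset.sum_add_distrib, sum_choose_cexp]
  have h2 : (1 - cexp ((k : ℂ) * I / 4)) ^ (2 * n)
      = cexp (n * (k / 4 : ℝ) * I) * (-4) ^ n * ((Real.sin (k / 8)) ^ (2 * n) : ℝ) := by
    have := one_sub_cexp_pow n (k / 4)
    rw [show k / 4 / 2 = k / 8 by ring] at this
    rw [← this]
    congr 3; push_cast; ring
  have h3 : (1 - cexp (-((k : ℂ) * I / 4))) ^ (2 * n)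
      = cexp (n * (-(k / 4) : ℝ) * I) * (-4) ^ n * ((Real.sin (k / 8)) ^ (2 * n) : ℝ) := by
    have := one_sub_cexp_pow n (-(k / 4))
    rw [show -(k / 4) / 2 = -(k / 8) by ring, Real.sin_neg, Even.neg_pow (even_two_mul n)] at this
    rw [← this]
    congr 3; push_cast; ring
  have h4 : cexp ((y₀ : ℂ) * I / 4) * cexp (n * (k / 4 : ℝ) * I)
      = cexp (((y₀ + n * k : ℝ) : ℂ) * I / 4) := by
    rw [← Complex.exp_add]; congr 1; push_cast; ring
  have h5 : cexp (-((y₀ : ℂ) * I / 4)) * cexp (n * (-(k / 4) : ℝ) * I)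
      = cexp (-(((y₀ + n * k : ℝ) : ℂ) * I / 4)) := by
    rw [← Complex.exp_add]; congr 1; push_cast; ring
  rw [h2, h3, ← cexp_add_cexp_neg (y₀ + n * k), ← h4, ← h5]
  ring


/-- The combined test function is a real nonnegative weight times the Gaussian. [folklore] -/
lemma sum_choose_tiltedGaussian (n : ℕ) (C y₀ k ξ : ℝ) :
    ∑ j ∈ Finset.range (2 * n + 1), ((2 * n).choose j : ℂ) * (-1) ^ j *
        tiltedGaussian C (y₀ + j * k) ξ
      = ((rexp (-(1 / C) * ξ ^ 2 + 2 * π * y₀ * ξ) * (rexp (2 * π * k * ξ) - 1) ^ (2 * n) : ℝ)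
          : ℂ) := by
  have h1 : ∀ j : ℕ, tiltedGaussian C (y₀ + j * k) ξ
      = cexp ((-(1 / (C : ℂ)) * (ξ : ℂ) ^ 2 + 2 * π * y₀ * ξ) + j * (2 * π * k * ξ)) := by
    intro j; rw [tiltedGaussian]; congr 1; push_cast; ring
  simp_rw [h1, sum_choose_cexp]
  have h2 : (rexp (2 * π * k * ξ) - 1) ^ (2 * n) = (1 - rexp (2 * π * k * ξ)) ^ (2 * n) := by
    rw [← neg_sub, Even.neg_pow (even_two_mul n)]
  have h3 : cexp (-(1 / (C : ℂ)) * (ξ : ℂ) ^ 2 + 2 * π * y₀ * ξ)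
      = ((rexp (-(1 / C) * ξ ^ 2 + 2 * π * y₀ * ξ) : ℝ) : ℂ) := by
    rw [Complex.ofReal_exp]; congr 1; push_cast; ring
  have h4 : cexp (2 * π * k * ξ : ℂ) = ((rexp (2 * π * k * ξ) : ℝ) : ℂ) := by
    rw [Complex.ofReal_exp]; congr 1; push_cast; ring
  rw [h2, h3, h4]
  norm_cast

/-- The sign of the limit in Hardy's argument: with the parity of `n` matched to `σ`, a
uniformly small theta part, and `2n+1` sample points, the real part of the limit is negative.
[folklore] -/
lemma re_limit_neg (n : ℕ) {σ y₀ k Amax : ℝ} (hσ : σ * (-1) ^ n = 1)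
    (hA : ∀ j ∈ Finset.range (2 * n + 1), ‖hardyTheta (((y₀ + j * k : ℝ) : ℂ) * I)‖ ≤ Amax)
    (hcos : 1 / 2 ≤ Real.cos ((y₀ + n * k) / 4))
    (hs : Amax < Real.sin (k / 8) ^ (2 * n)) :
    (∑ j ∈ Finset.range (2 * n + 1), ((2 * n).choose j : ℂ) * (-1) ^ j *
      ((σ : ℂ) * hardyKernel (((y₀ + j * k : ℝ) : ℂ) * I))).re < 0 := by
  set s := Real.sin (k / 8) ^ (2 * n) with hs_def
  set c := Real.cos ((y₀ + n * k) / 4) with hc_def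
  -- split `hardyKernel = hardyTheta - (exp + exp)` and evaluate the elementary part
  have hsplit : ∑ j ∈ Finset.range (2 * n + 1), ((2 * n).choose j : ℂ) * (-1) ^ j *
      ((σ : ℂ) * hardyKernel (((y₀ + j * k : ℝ) : ℂ) * I))
      = (σ : ℂ) * ∑ j ∈ Finset.range (2 * n + 1), ((2 * n).choose j : ℂ) * (-1) ^ j *
          hardyTheta (((y₀ + j * k : ℝ) : ℂ) * I)
        - (σ : ℂ) * ((-4 : ℂ) ^ n * (s : ℂ) * ((2 * c : ℝ) : ℂ)) := by
    rw [hs_def, hc_def, ← sum_choose_cexp_cos, Finset.mul_sum, Finset.mul_sum,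
      ← Finset.sum_sub_distrib]
    refine Finset.sum_congr rfl fun j _ ↦ ?_
    simp only [hardyKernel]
    ring
  rw [hsplit, sub_re]
  have hre1 : ((σ : ℂ) * ∑ j ∈ Finset.range (2 * n + 1), ((2 * n).choose j : ℂ) * (-1) ^ j *
      hardyTheta (((y₀ + j * k : ℝ) : ℂ) * I)).re
      = σ * ∑ j ∈ Finset.range (2 * n + 1), ((2 * n).choose j : ℝ) * (-1) ^ j *
        (hardyTheta (((y₀ + j * k : ℝ) : ℂ) * I)).re := by
    rw [re_ofReal_mul, re_sum]
    congr 1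
    refine Finset.sum_congr rfl fun j _ ↦ ?_
    have : ((2 * n).choose j : ℂ) * (-1) ^ j = ((((2 * n).choose j : ℝ) * (-1) ^ j : ℝ) : ℂ) := by
      push_cast; ring
    rw [this, re_ofReal_mul]
  have hre2 : ((σ : ℂ) * ((-4 : ℂ) ^ n * (s : ℂ) * ((2 * c : ℝ) : ℂ))).re
      = σ * ((-4) ^ n * s * (2 * c)) := by
    have : ((-4 : ℂ) ^ n * (s : ℂ) * ((2 * c : ℝ) : ℂ)) =
        (((-4 : ℝ) ^ n * s * (2 * c) : ℝ) : ℂ) := by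
      push_cast; ring
    rw [this, re_ofReal_mul, ofReal_re]
  rw [hre1, hre2]
  -- bound the theta part
  have hσ1 : |σ| = 1 := by
    have h := congrArg abs hσ
    rw [abs_mul, abs_pow, abs_neg, abs_one, one_pow, mul_one] at h
    exact h
  have hbound : |σ * ∑ j ∈ Finset.range (2 * n + 1), ((2 * n).choose j : ℝ) * (-1) ^ j *
      (hardyTheta (((y₀ + j * k : ℝ) : ℂ) * I)).re| ≤ 4 ^ n * Amax := by
    rw [abs_mul, hσ1, one_mul]
    refine (Finset.abs_sum_le_sum_abs _ _).trans ?_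
    calc ∑ j ∈ Finset.range (2 * n + 1), |((2 * n).choose j : ℝ) * (-1) ^ j *
          (hardyTheta (((y₀ + j * k : ℝ) : ℂ) * I)).re|
        ≤ ∑ j ∈ Finset.range (2 * n + 1), ((2 * n).choose j : ℝ) * Amax := by
          refine Finset.sum_le_sum fun j hj ↦ ?_
          rw [abs_mul, abs_mul, abs_pow, abs_neg, abs_one, one_pow, mul_one, Nat.abs_cast]
          exact mul_le_mul_of_nonneg_left ((abs_re_le_norm _).trans (hA j hj)) (Nat.cast_nonneg _)
      _ = 4 ^ n * Amax := by
          rw [← Finset.sum_mul]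
          congr 1
          have h := Nat.sum_range_choose (2 * n)
          rw [pow_mul] at h
          exact_mod_cast h
  have hmain : σ * ((-4) ^ n * s * (2 * c)) = 4 ^ n * s * (2 * c) := by
    have : (-4 : ℝ) ^ n = (-1) ^ n * 4 ^ n := by rw [← mul_pow]; norm_num
    rw [this]
    linear_combination (4 ^ n * s * (2 * c)) * hσ
  rw [hmain]
  have h4 : (0 : ℝ) < 4 ^ n := by positivity
  have hs0 : 0 ≤ s := hs_def ▸ Even.pow_nonneg (even_two_mul n) _
  nlinarith [(abs_le.mp hbound).2, mul_lt_mul_of_pos_left hs h4,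
    mul_le_mul_of_nonneg_left (show (1 : ℝ) ≤ 2 * c by linarith) (mul_nonneg h4.le hs0)]

/-! ### The real function `riemannIntegrand = re ∘ 𝓕hardyKernelReal` and the lower bound -/

/-- `hardyF = re ∘ 𝓕 hardyKernelReal`; since `𝓕 hardyKernelReal` is real-valued, `(hardyF ξ : ℂ) =
𝓕 hardyKernelReal ξ`. [folklore] -/
def hardyF (ξ : ℝ) : ℝ := (𝓕 hardyKernelReal ξ).re

/-- `(hardyF ξ : ℂ) = 𝓕 Φℝ ξ`, since the Fourier transform of Hardy's kernel is real. [folklore] -/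
lemma hardyF_coe (ξ : ℝ) : (hardyF ξ : ℂ) = 𝓕 hardyKernelReal ξ :=
  (fourier_hardyKernelReal_eq_re ξ).symm

/-- `hardyF` is continuous. [folklore] -/
lemma continuous_hardyF : Continuous hardyF :=
  Complex.continuous_re.comp continuous_fourier_hardyKernelReal

/-- `hardyF` is even. [folklore] -/
lemma hardyF_neg (ξ : ℝ) : hardyF (-ξ) = hardyF ξ := by
  simp only [hardyF, fourier_hardyKernelReal_neg]

/-- `|hardyF ξ| ≤ ‖Φℝ‖_{L¹}`. [folklore] -/
lemma abs_hardyF_le (ξ : ℝ) : |hardyF ξ| ≤ ∫ x, ‖hardyKernelReal x‖ :=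
  (abs_re_le_norm _).trans (norm_fourier_hardyKernelReal_le ξ)

/-- `|e^{hξ} - 1| ≤ e^{hT} - 1` for `|ξ| ≤ T`, `h ≥ 0`. [folklore] -/
lemma abs_rexp_sub_one_le {h ξ T : ℝ} (hh : 0 ≤ h) (hξ : |ξ| ≤ T) :
    |rexp (h * ξ) - 1| ≤ rexp (h * T) - 1 := by
  have hT : ξ ≤ T := (le_abs_self ξ).trans hξ
  have hT' : -T ≤ ξ := (abs_le.mp hξ).1
  rcases le_or_gt 0 ξ with hx | hx
  · rw [abs_of_nonneg (by simpa using Real.one_le_exp (mul_nonneg hh hx))]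
    gcongr
  · have h0 : rexp (h * ξ) ≤ 1 := Real.exp_le_one_iff.mpr (by nlinarith)
    rw [abs_sub_comm, abs_of_nonneg (by linarith)]
    have h1 : rexp (-(h * T)) ≤ rexp (h * ξ) := Real.exp_le_exp.mpr (by nlinarith)
    have h2 : 2 ≤ rexp (h * T) + rexp (-(h * T)) := by
      have := Real.one_le_cosh (h * T); rw [Real.cosh_eq] at this; linarith
    linarith

/-- **Lower bound** (Titchmarsh §10.2, last display): if `σ riemannIntegrand > 0` for `|ξ| ≥ T`,
the weighted integral of `σ riemannIntegrand` against `e^{-ξ²/C + 2π y₀ ξ} (e^{hξ} - 1)^{2n}` is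
bounded below by the mass near `[2T, 2T+1]` minus the contribution of `[-T, T]`.
[cite: Titchmarsh1986, §10.2 (first method, last two displays)] -/
lemma integral_lower_bound {T M₀ m σ h y₀ C : ℝ} {n : ℕ} (hT : 0 < T) (hh : 0 < h)
    (hy₀ : 0 ≤ y₀) (hC : 0 < C)
    (hM₀ : ∀ ξ, |hardyF ξ| ≤ M₀) (hpos : ∀ ξ, T ≤ |ξ| → 0 < σ * hardyF ξ)
    (hm : ∀ ξ ∈ Icc (2 * T) (2 * T + 1), m ≤ σ * hardyF ξ) (hm0 : 0 ≤ m) (hσ : |σ| = 1)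
    (hint : Integrable (fun ξ ↦ σ * hardyF ξ *
      (rexp (-(1 / C) * ξ ^ 2 + 2 * π * y₀ * ξ) * (rexp (h * ξ) - 1) ^ (2 * n)))) :
    m * (rexp (2 * h * T) - 1) ^ (2 * n) * rexp (-(1 / C) * (2 * T + 1) ^ 2)
      - 2 * T * (M₀ * rexp (2 * π * y₀ * T) * (rexp (h * T) - 1) ^ (2 * n))
    ≤ ∫ ξ, σ * hardyF ξ *
      (rexp (-(1 / C) * ξ ^ 2 + 2 * π * y₀ * ξ) * (rexp (h * ξ) - 1) ^ (2 * n)) := by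
  set c₁ := m * (rexp (2 * h * T) - 1) ^ (2 * n) * rexp (-(1 / C) * (2 * T + 1) ^ 2) with hc₁
  set c₂ := M₀ * rexp (2 * π * y₀ * T) * (rexp (h * T) - 1) ^ (2 * n) with hc₂
  have hM₀' : 0 ≤ M₀ := (abs_nonneg _).trans (hM₀ 0)
  have hehT : 0 ≤ rexp (h * T) - 1 := by
    simpa using Real.one_le_exp (by positivity : 0 ≤ h * T)
  have he2hT : 0 ≤ rexp (2 * h * T) - 1 := by
    simpa using Real.one_le_exp (by positivity : 0 ≤ 2 * h * T)
  set b : ℝ → ℝ := fun ξ ↦ (Icc (2 * T) (2 * T + 1)).indicator (fun _ ↦ c₁) ξ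
    - (Icc (-T) T).indicator (fun _ ↦ c₂) ξ with hb
  have hb1 : Integrable ((Icc (2 * T) (2 * T + 1)).indicator (fun _ : ℝ ↦ c₁)) :=
    (integrableOn_const (by simp)).integrable_indicator measurableSet_Icc
  have hb2 : Integrable ((Icc (-T) T).indicator (fun _ : ℝ ↦ c₂)) :=
    (integrableOn_const (by simp)).integrable_indicator measurableSet_Icc
  have hb_int : Integrable b := hb1.sub hb2
  have hb_val : ∫ ξ, b ξ = c₁ - 2 * T * c₂ := by
    rw [hb, integral_sub hb1 hb2, integral_indicator_const _ measurableSet_Icc,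
      integral_indicator_const _ measurableSet_Icc, Real.volume_real_Icc_of_le (by linarith),
      Real.volume_real_Icc_of_le (by linarith), smul_eq_mul, smul_eq_mul]
    ring
  rw [← hb_val]
  refine integral_mono hb_int hint fun ξ ↦ ?_
  -- pointwise comparison
  set E := rexp (-(1 / C) * ξ ^ 2 + 2 * π * y₀ * ξ) with hE
  set W := (rexp (h * ξ) - 1) ^ (2 * n) with hW
  have hEpos : 0 < E := Real.exp_pos _
  have hW0 : 0 ≤ W := hW ▸ Even.pow_nonneg (even_two_mul n) _
  show b ξ ≤ σ * hardyF ξ * (E * W)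
  by_cases h1 : ξ ∈ Icc (2 * T) (2 * T + 1)
  · have h2 : ξ ∉ Icc (-T) T := fun h' ↦ by linarith [h1.1, h'.2]
    simp only [hb, indicator_of_mem h1, indicator_of_notMem h2, sub_zero]
    have hξT : T ≤ |ξ| := by rw [abs_of_nonneg (by linarith [h1.1])]; linarith [h1.1]
    have hF : m ≤ σ * hardyF ξ := hm ξ h1
    have hE' : rexp (-(1 / C) * (2 * T + 1) ^ 2) ≤ E := by
      rw [hE, Real.exp_le_exp]
      have : ξ ^ 2 ≤ (2 * T + 1) ^ 2 := by
        have := h1.2; have := h1.1; nlinarith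
      have : 0 ≤ 2 * π * y₀ * ξ := mul_nonneg (by positivity) (by linarith [h1.1])
      have hC' : 0 < 1 / C := by positivity
      nlinarith
    have hW' : (rexp (2 * h * T) - 1) ^ (2 * n) ≤ W := by
      rw [hW]
      apply pow_le_pow_left₀ he2hT
      have : rexp (2 * h * T) ≤ rexp (h * ξ) := Real.exp_le_exp.mpr (by nlinarith [h1.1])
      linarith
    calc c₁ = m * ((rexp (2 * h * T) - 1) ^ (2 * n) * rexp (-(1 / C) * (2 * T + 1) ^ 2)) := by
          rw [hc₁]; ring
      _ ≤ σ * hardyF ξ * (W * E) := by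
          apply mul_le_mul hF _ (by positivity) (hm0.trans hF)
          exact mul_le_mul hW' hE' (Real.exp_pos _).le hW0
      _ = σ * hardyF ξ * (E * W) := by ring
  · by_cases h2 : ξ ∈ Icc (-T) T
    · simp only [hb, indicator_of_notMem h1, indicator_of_mem h2, zero_sub]
      have hξT : |ξ| ≤ T := abs_le.mpr ⟨by linarith [h2.1], h2.2⟩
      have hF : |σ * hardyF ξ| ≤ M₀ := by rw [abs_mul, hσ, one_mul]; exact hM₀ ξ
      have hE' : E ≤ rexp (2 * π * y₀ * T) := by
        rw [hE, Real.exp_le_exp]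
        have : 0 ≤ 1 / C * ξ ^ 2 := by positivity
        have : 2 * π * y₀ * ξ ≤ 2 * π * y₀ * T := by
          have := h2.2
          exact mul_le_mul_of_nonneg_left this (by positivity)
        nlinarith
      have hW' : W ≤ (rexp (h * T) - 1) ^ (2 * n) := by
        rw [hW, ← Even.pow_abs (even_two_mul n) (rexp (h * ξ) - 1)]
        exact pow_le_pow_left₀ (abs_nonneg _) (abs_rexp_sub_one_le hh.le hξT) _
      have : |σ * hardyF ξ * (E * W)| ≤ c₂ := by
        rw [abs_mul (σ * hardyF ξ), abs_mul E W, abs_of_pos hEpos, abs_of_nonneg hW0, hc₂]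
        calc |σ * hardyF ξ| * (E * W)
            ≤ M₀ * (rexp (2 * π * y₀ * T) * (rexp (h * T) - 1) ^ (2 * n)) :=
              mul_le_mul hF (mul_le_mul hE' hW' hW0 (Real.exp_pos _).le) (by positivity) hM₀'
          _ = _ := by ring
      linarith [neg_abs_le (σ * hardyF ξ * (E * W))]
    · simp only [hb, indicator_of_notMem h1, indicator_of_notMem h2, sub_zero]
      have hξT : T ≤ |ξ| := by
        simp only [mem_Icc, not_and_or, not_le] at h2
        rcases h2 with h2 | h2
        · rw [abs_of_neg (by linarith)]; linarith
        · rw [abs_of_pos (by linarith)]; linarith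
      have := hpos ξ hξT
      positivity


/-! ### Hardy's theorem for `𝓕 hardyKernelReal` -/

/-- If `hardyF` has finitely many zeros then it does not vanish for `|ξ| ≥ T`, some `T > 0`.
[folklore] -/
lemma exists_bound_of_finite (hfin : {ξ : ℝ | hardyF ξ = 0}.Finite) :
    ∃ T : ℝ, 0 < T ∧ ∀ ξ, T ≤ |ξ| → hardyF ξ ≠ 0 := by
  obtain ⟨R₁, hR₁⟩ := hfin.bddAbove
  obtain ⟨R₂, hR₂⟩ := hfin.bddBelow
  refine ⟨max (max R₁ (-R₂)) 0 + 1, by positivity, fun ξ hξ h0 ↦ ?_⟩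
  have h1 : ξ ≤ R₁ := hR₁ h0
  have h2 : R₂ ≤ ξ := hR₂ h0
  have : |ξ| ≤ max R₁ (-R₂) := abs_le.mpr ⟨by linarith [le_max_right R₁ (-R₂)],
    h1.trans (le_max_left _ _)⟩
  linarith [le_max_left (max R₁ (-R₂)) 0]

/-- `hardyF |ξ| = hardyF ξ`. [folklore] -/
lemma hardyF_abs (ξ : ℝ) : hardyF |ξ| = hardyF ξ := by
  rcases le_or_gt 0 ξ with h | h
  · rw [abs_of_nonneg h]
  · rw [abs_of_neg h, hardyF_neg]

/-- If `hardyF` has no zeros with `|ξ| ≥ T`, then it has constant sign there. [folklore] -/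
lemma exists_sign {T : ℝ} (hT : 0 < T) (hne : ∀ ξ, T ≤ |ξ| → hardyF ξ ≠ 0) :
    ∃ σ : ℝ, |σ| = 1 ∧ (σ = 1 ∨ σ = -1) ∧ ∀ ξ, T ≤ |ξ| → 0 < σ * hardyF ξ := by
  have hFT : hardyF T ≠ 0 := hne T (by rw [abs_of_pos hT])
  have key : ∀ ξ, T ≤ ξ → 0 < hardyF T * hardyF ξ := by
    intro ξ hξ
    by_contra hcon
    push Not at hcon
    have hcont : ContinuousOn hardyF (uIcc T ξ) := continuous_hardyF.continuousOn
    have h0 : (0 : ℝ) ∈ uIcc (hardyF T) (hardyF ξ) := by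
      rcases lt_or_gt_of_ne hFT with h | h
      · have : 0 ≤ hardyF ξ := by nlinarith
        exact mem_uIcc.mpr (Or.inl ⟨h.le, this⟩)
      · have : hardyF ξ ≤ 0 := by nlinarith
        exact mem_uIcc.mpr (Or.inr ⟨this, h.le⟩)
    obtain ⟨c, hc, hc0⟩ := intermediate_value_uIcc hcont h0
    rw [uIcc_of_le hξ] at hc
    exact hne c (by rw [abs_of_pos (by linarith [hc.1])]; exact hc.1) hc0
  have key' : ∀ ξ, T ≤ |ξ| → 0 < hardyF T * hardyF ξ := fun ξ hξ ↦ by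
    rw [← hardyF_abs ξ]; exact key _ hξ
  rcases lt_or_gt_of_ne hFT with h | h
  · refine ⟨-1, by simp, Or.inr rfl, fun ξ hξ ↦ ?_⟩
    have := key' ξ hξ
    nlinarith
  · refine ⟨1, by simp, Or.inl rfl, fun ξ hξ ↦ ?_⟩
    have := key' ξ hξ
    nlinarith

/-- The binomial combination of the tested integrals is the (real) integral of `σ
riemannIntegrand` against the nonnegative weight `e^{-ξ²/C + 2π y₀ ξ} (e^{2πkξ} - 1)^{2n}`.
[folklore] -/
lemma weighted_integral_eq (n : ℕ) (σ y₀ k : ℝ) {C : ℝ} (hC : 0 < C) :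
    ∑ j ∈ Finset.range (2 * n + 1), ((2 * n).choose j : ℂ) * (-1) ^ j *
        ((σ : ℂ) * ∫ ξ : ℝ, 𝓕 hardyKernelReal ξ * tiltedGaussian C (y₀ + j * k) ξ)
      = ((∫ ξ : ℝ, σ * hardyF ξ * (rexp (-(1 / C) * ξ ^ 2 + 2 * π * y₀ * ξ) *
          (rexp (2 * π * k * ξ) - 1) ^ (2 * n)) : ℝ) : ℂ)
    ∧ Integrable (fun ξ : ℝ ↦ σ * hardyF ξ * (rexp (-(1 / C) * ξ ^ 2 + 2 * π * y₀ * ξ) *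
          (rexp (2 * π * k * ξ) - 1) ^ (2 * n))) := by
  have hint_j : ∀ j ∈ Finset.range (2 * n + 1), Integrable (fun ξ : ℝ ↦
      ((2 * n).choose j : ℂ) * (-1) ^ j *
        ((σ : ℂ) * (𝓕 hardyKernelReal ξ * tiltedGaussian C (y₀ + j * k) ξ))) := by
    intro j _
    refine ((Integrable.bdd_mul (c := ∫ x, ‖hardyKernelReal x‖) (integrable_tiltedGaussian hC _)
      continuous_fourier_hardyKernelReal.aestronglyMeasurable
      (ae_of_all _ fun ξ ↦ norm_fourier_hardyKernelReal_le ξ)).const_mul _).const_mul _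
  have hsum_int := integrable_finsetSum _ hint_j
  have hpt : ∀ ξ : ℝ, ∑ j ∈ Finset.range (2 * n + 1), ((2 * n).choose j : ℂ) * (-1) ^ j *
      ((σ : ℂ) * (𝓕 hardyKernelReal ξ * tiltedGaussian C (y₀ + j * k) ξ))
      = ((σ * hardyF ξ * (rexp (-(1 / C) * ξ ^ 2 + 2 * π * y₀ * ξ) *
          (rexp (2 * π * k * ξ) - 1) ^ (2 * n)) : ℝ) : ℂ) := by
    intro ξ
    have hG := sum_choose_tiltedGaussian n C y₀ k ξ
    rw [← hardyF_coe]
    calc _ = (σ : ℂ) * (hardyF ξ : ℂ) * ∑ j ∈ Finset.range (2 * n + 1),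
          ((2 * n).choose j : ℂ) * (-1) ^ j * tiltedGaussian C (y₀ + j * k) ξ := by
          rw [Finset.mul_sum]
          exact Finset.sum_congr rfl fun j _ ↦ by ring
      _ = _ := by rw [hG]; push_cast; ring
  constructor
  · rw [← integral_complex_ofReal]
    simp_rw [← hpt]
    rw [integral_finsetSum _ hint_j]
    refine Finset.sum_congr rfl fun j _ ↦ ?_
    rw [integral_const_mul, integral_const_mul]
  · refine (hsum_int.re).congr (ae_of_all _ fun ξ ↦ ?_)
    simp only [hpt, RCLike.re_to_complex, ofReal_re]

/-- Positivity of the limiting lower bound, by the choice of `n`. [folklore] -/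
lemma limit_lower_bound_pos {T M₀ m h y₀ : ℝ} {n : ℕ} (hT : 0 < T) (hh : 0 < h) (hm : 0 < m)
    (hM₀ : 0 ≤ M₀) (hy₀ : y₀ ≤ π / 2) (hn : 2 * T * (M₀ * rexp (π ^ 2 * T)) < 4 ^ n * m) :
    0 < m * (rexp (2 * h * T) - 1) ^ (2 * n)
      - 2 * T * (M₀ * rexp (2 * π * y₀ * T) * (rexp (h * T) - 1) ^ (2 * n)) := by
  set W := (rexp (h * T) - 1) ^ (2 * n) with hW
  have hW0 : 0 < W := by
    apply pow_pos
    have : 1 < rexp (h * T) := Real.one_lt_exp_iff.mpr (by positivity)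
    linarith
  have h1 : 4 ^ n * W ≤ (rexp (2 * h * T) - 1) ^ (2 * n) := by
    have h2 : 2 * (rexp (h * T) - 1) ≤ rexp (2 * h * T) - 1 := by
      have e2 : rexp (2 * h * T) = rexp (h * T) ^ 2 := by
        rw [← Real.exp_nat_mul]; ring_nf
      rw [e2]
      nlinarith [sq_nonneg (rexp (h * T) - 1)]
    have h3 : 0 ≤ 2 * (rexp (h * T) - 1) := by
      have : 1 ≤ rexp (h * T) := Real.one_le_exp (by positivity)
      linarith
    calc 4 ^ n * W = (2 * (rexp (h * T) - 1)) ^ (2 * n) := by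
          rw [hW, mul_pow]; congr 1; rw [pow_mul]; norm_num
      _ ≤ (rexp (2 * h * T) - 1) ^ (2 * n) := pow_le_pow_left₀ h3 h2 _
  have h2 : rexp (2 * π * y₀ * T) ≤ rexp (π ^ 2 * T) := by
    rw [Real.exp_le_exp]
    have : 2 * π * y₀ ≤ π ^ 2 := by nlinarith [pi_pos]
    exact mul_le_mul_of_nonneg_right this hT.le
  have h3 : m * (4 ^ n * W) ≤ m * (rexp (2 * h * T) - 1) ^ (2 * n) :=
    mul_le_mul_of_nonneg_left h1 hm.le
  have h4 : 2 * T * (M₀ * rexp (2 * π * y₀ * T) * W)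
      ≤ 2 * T * (M₀ * rexp (π ^ 2 * T) * W) := by gcongr
  have h5 : 0 < W * (4 ^ n * m - 2 * T * (M₀ * rexp (π ^ 2 * T))) := mul_pos hW0 (by linarith)
  nlinarith

/-- **Hardy's theorem, Fourier form**: the Fourier transform of Hardy's kernel `hardyKernelReal`
(which is `2 Λ(1/2 + 4π i ξ)`) has infinitely many real zeros.
[cite: Titchmarsh1986, §10.2 (first method)] -/
theorem fourier_hardyKernelReal_zeros_infinite : {ξ : ℝ | 𝓕 hardyKernelReal ξ = 0}.Infinite := by
  have hiff : ∀ ξ, 𝓕 hardyKernelReal ξ = 0 ↔ hardyF ξ = 0 := fun ξ ↦ by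
    rw [← hardyF_coe, ofReal_eq_zero]
  simp_rw [hiff]
  intro hfin
  obtain ⟨T, hT, hne⟩ := exists_bound_of_finite hfin
  obtain ⟨σ, hσabs, hσ, hpos⟩ := exists_sign hT hne
  -- the constants `M₀` and `m`
  set M₀ := ∫ x, ‖hardyKernelReal x‖ with hM₀
  have hM₀F : ∀ ξ, |hardyF ξ| ≤ M₀ := abs_hardyF_le
  have hM₀nn : 0 ≤ M₀ := integral_nonneg fun _ ↦ norm_nonneg _
  obtain ⟨x₀, hx₀, hmin⟩ := (isCompact_Icc (a := 2 * T) (b := 2 * T + 1)).exists_isMinOn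
    (nonempty_Icc.mpr (by linarith)) ((continuous_const.mul continuous_hardyF).continuousOn
      (s := Icc (2 * T) (2 * T + 1)) (f := fun ξ ↦ σ * hardyF ξ))
  set m := σ * hardyF x₀ with hm_def
  have hm_pos : 0 < m := hpos x₀ (by rw [abs_of_pos (by linarith [hx₀.1])]; linarith [hx₀.1])
  have hm : ∀ ξ ∈ Icc (2 * T) (2 * T + 1), m ≤ σ * hardyF ξ := fun ξ hξ ↦ hmin hξ
  -- choice of `n`
  obtain ⟨n, hn1, hσn, hRn⟩ : ∃ n : ℕ, 1 ≤ n ∧ σ * (-1) ^ n = 1 ∧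
      2 * T * (M₀ * rexp (π ^ 2 * T)) < 4 ^ n * m := by
    obtain ⟨n₁, hn₁⟩ := pow_unbounded_of_one_lt (2 * T * (M₀ * rexp (π ^ 2 * T)) / m)
      (by norm_num : (1 : ℝ) < 4)
    have h4 : ∀ n : ℕ, n₁ ≤ n → 2 * T * (M₀ * rexp (π ^ 2 * T)) < 4 ^ n * m := fun n hn ↦ by
      rw [div_lt_iff₀ hm_pos] at hn₁
      exact lt_of_lt_of_le hn₁ (mul_le_mul_of_nonneg_right
        (pow_le_pow_right₀ (by norm_num) hn) hm_pos.le)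
    rcases hσ with rfl | rfl
    · exact ⟨2 * (n₁ + 1), by omega, by rw [pow_mul]; norm_num, h4 _ (by omega)⟩
    · exact ⟨2 * (n₁ + 1) + 1, by omega, by rw [pow_succ, pow_mul]; norm_num, h4 _ (by omega)⟩
  have hn0 : (0 : ℝ) < n := by exact_mod_cast hn1
  -- choice of `η` and the sample points `yⱼ = y₀ + j k`
  obtain ⟨δ₀, hδ₀, hA⟩ := norm_hardyTheta_mul_I_small (2 * n) (ε := 1 / (2 * (8 * π * n) ^ (2 * n)))
    (by positivity)
  set η := min δ₀ (π / 8) with hη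
  have hη0 : 0 < η := lt_min hδ₀ (by positivity)
  have hηδ : η ≤ δ₀ := min_le_left _ _
  have hηπ : η ≤ π / 8 := min_le_right _ _
  set k := η / (2 * n) with hk
  have hk0 : 0 < k := by positivity
  have hnk : (n : ℝ) * k = η / 2 := by rw [hk]; field_simp
  have hn1' : (1 : ℝ) ≤ n := by exact_mod_cast hn1
  have hkη : k ≤ η := by
    rw [hk]; exact div_le_self hη0.le (by linarith)
  set y₀ := π / 2 - 2 * η with hy₀
  have hy₀nn : 0 ≤ y₀ := by rw [hy₀]; linarith [pi_pos]
  have hy₀le : y₀ ≤ π / 2 := by rw [hy₀]; linarith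
  have hyj : ∀ j ∈ Finset.range (2 * n + 1),
      η ≤ π / 2 - (y₀ + j * k) ∧ π / 2 - (y₀ + j * k) ≤ 2 * η := by
    intro j hj
    have hj' : (j : ℝ) ≤ 2 * n := by exact_mod_cast Nat.lt_succ_iff.mp (Finset.mem_range.mp hj)
    have h1 : (j : ℝ) * k ≤ 2 * n * k := by gcongr
    have h2 : 0 ≤ (j : ℝ) * k := by positivity
    constructor <;> nlinarith
  have hyj_abs : ∀ j ∈ Finset.range (2 * n + 1), |y₀ + j * k| < π / 2 := by
    intro j hj
    obtain ⟨h1, h2⟩ := hyj j hj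
    rw [abs_of_nonneg (by nlinarith [pi_pos])]
    linarith
  -- the limit `L` and its sign
  set L : ℂ := ∑ j ∈ Finset.range (2 * n + 1), ((2 * n).choose j : ℂ) * (-1) ^ j *
    ((σ : ℂ) * hardyKernel (((y₀ + j * k : ℝ) : ℂ) * I)) with hL
  have hLneg : L.re < 0 := by
    apply re_limit_neg n hσn (Amax := 1 / (2 * (8 * π * n) ^ (2 * n)) * η ^ (2 * n))
    · intro j hj
      obtain ⟨h1, h2⟩ := hyj j hj
      exact hA η _ hη0 hηδ h1 h2
    · have h1 : 0 ≤ (y₀ + n * k) / 4 := by nlinarith [pi_pos]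
      have h2 : (y₀ + n * k) / 4 ≤ π / 3 := by nlinarith [pi_pos]
      rw [← Real.cos_pi_div_three]
      exact Real.cos_le_cos_of_nonneg_of_le_pi h1 (by linarith [pi_pos]) h2
    · have hs : η / (8 * π * n) ≤ Real.sin (k / 8) := by
        have := Real.mul_le_sin (x := k / 8) (by positivity) (by linarith [pi_pos])
        calc η / (8 * π * n) = 2 / π * (k / 8) := by rw [hk]; field_simp
          _ ≤ Real.sin (k / 8) := this
      have hs0 : 0 < η / (8 * π * n) := by positivity
      have hX : 0 < (8 * π * n) ^ (2 * n) := by positivity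
      calc 1 / (2 * (8 * π * n) ^ (2 * n)) * η ^ (2 * n)
          < (η / (8 * π * n)) ^ (2 * n) := by
            rw [div_pow, div_eq_mul_one_div (η ^ (2 * n)), mul_comm]
            apply mul_lt_mul_of_pos_left _ (by positivity)
            rw [one_div_lt_one_div (by positivity) hX]
            linarith
        _ ≤ Real.sin (k / 8) ^ (2 * n) := pow_le_pow_left₀ hs0.le hs _
  -- the weighted integrals converge to `L` ...
  have hJ : Tendsto (fun C : ℝ ↦ ∑ j ∈ Finset.range (2 * n + 1), ((2 * n).choose j : ℂ) *
      (-1) ^ j * ((σ : ℂ) * ∫ ξ : ℝ, 𝓕 hardyKernelReal ξ * tiltedGaussian C (y₀ + j * k) ξ))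
      atTop (𝓝 L) := by
    apply tendsto_finsetSum
    intro j hj
    exact ((tendsto_integral_fourier_hardyKernelReal_mul_tiltedGaussian
      (hyj_abs j hj)).const_mul (σ : ℂ)).const_mul _
  -- ... hence the real weighted integrals converge to `re L`
  have hIlim : Tendsto (fun C : ℝ ↦ ∫ ξ : ℝ, σ * hardyF ξ *
      (rexp (-(1 / C) * ξ ^ 2 + 2 * π * y₀ * ξ) * (rexp (2 * π * k * ξ) - 1) ^ (2 * n)))
      atTop (𝓝 L.re) := by
    have := (Complex.continuous_re.tendsto L).comp hJ
    refine this.congr' ?_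
    filter_upwards [eventually_gt_atTop 0] with C hC
    rw [Function.comp_apply, (weighted_integral_eq n σ y₀ k hC).1, ofReal_re]
  -- lower bound for the real weighted integrals
  have hh0 : 0 < 2 * π * k := by positivity
  set B : ℝ → ℝ := fun C ↦ m * (rexp (2 * (2 * π * k) * T) - 1) ^ (2 * n) *
      rexp (-(1 / C) * (2 * T + 1) ^ 2)
    - 2 * T * (M₀ * rexp (2 * π * y₀ * T) * (rexp ((2 * π * k) * T) - 1) ^ (2 * n)) with hB
  have hlow : ∀ᶠ C : ℝ in atTop, B C ≤ ∫ ξ : ℝ, σ * hardyF ξ *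
      (rexp (-(1 / C) * ξ ^ 2 + 2 * π * y₀ * ξ) * (rexp (2 * π * k * ξ) - 1) ^ (2 * n)) := by
    filter_upwards [eventually_gt_atTop 0] with C hC
    exact integral_lower_bound hT hh0 hy₀nn hC hM₀F hpos hm hm_pos.le hσabs
      (weighted_integral_eq n σ y₀ k hC).2
  set B₀ : ℝ := m * (rexp (2 * (2 * π * k) * T) - 1) ^ (2 * n) * 1
    - 2 * T * (M₀ * rexp (2 * π * y₀ * T) * (rexp ((2 * π * k) * T) - 1) ^ (2 * n)) with hB₀
  have hBlim : Tendsto B atTop (𝓝 B₀) := by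
    refine Tendsto.sub (Tendsto.const_mul _ ?_) tendsto_const_nhds
    have h1 : Tendsto (fun C : ℝ ↦ -(1 / C) * (2 * T + 1) ^ 2) atTop
        (𝓝 (-(0 : ℝ) * (2 * T + 1) ^ 2)) :=
      ((tendsto_const_nhds.div_atTop tendsto_id).neg.mul_const _)
    rw [neg_zero, zero_mul] at h1
    have h2 := (Real.continuous_exp.tendsto 0).comp h1
    rw [Real.exp_zero] at h2
    exact h2
  have hle : B₀ ≤ L.re := le_of_tendsto_of_tendsto hBlim hIlim hlow
  -- but `B₀ > 0` by the choice of `n`: contradiction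
  have hBpos : 0 < B₀ := by
    rw [hB₀, mul_one]
    exact limit_lower_bound_pos hT hh0 hm_pos hM₀nn hy₀le hRn
  linarith

/-! ### Hardy's theorem -/

/-- The zeros of `ζ` on the critical line correspond to the real zeros of `𝓕 hardyKernelReal`.
[folklore] -/
lemma riemannZeta_one_half_add_eq_zero_iff (t : ℝ) :
    riemannZeta (1 / 2 + t * I) = 0 ↔ 𝓕 hardyKernelReal (t / (4 * π)) = 0 := by
  have hs : (1 / 2 + t * I : ℂ) ≠ 0 := fun h ↦ by
    have := congrArg Complex.re h; simp at this
  have hre : 0 < (1 / 2 + t * I : ℂ).re := by simp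
  rw [riemannZeta_def_of_ne_zero hs, div_eq_zero_iff, completedRiemannZeta_critical_line,
    div_eq_zero_iff]
  have hΓ := Complex.Gammaℝ_ne_zero_of_re_pos hre
  constructor
  · rintro ((h | h) | h)
    · exact h
    · norm_num at h
    · exact absurd h hΓ
  · intro h; exact Or.inl (Or.inl h)

/-- **Hardy's theorem** (1914): infinitely many zeros of `ζ` lie on the critical line.
[cite: Hardy1914, C. R. Acad. Sci. Paris 158 (1914), 1012–1014; proof: Titchmarsh1986 §10.2] -/
theorem riemannZeta_zeros_on_critical_line_infinite :
    {t : ℝ | riemannZeta (1 / 2 + t * I) = 0}.Infinite := by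
  have hsub : {ξ : ℝ | 𝓕 hardyKernelReal ξ = 0} ⊆
      (fun t : ℝ ↦ t / (4 * π)) '' {t : ℝ | riemannZeta (1 / 2 + t * I) = 0} := by
    intro ξ hξ
    have hξ' : 4 * π * ξ / (4 * π) = ξ := by field_simp
    refine ⟨4 * π * ξ, ?_, hξ'⟩
    simp only [mem_setOf_eq] at hξ ⊢
    rw [riemannZeta_one_half_add_eq_zero_iff, hξ']
    exact hξ
  intro hfin
  exact fourier_hardyKernelReal_zeros_infinite ((hfin.image _).subset hsub)

end Literature.NumberTheory.LFunctions.Hardy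


namespace Literature.NumberTheory.LFunctions

/-- Discharge of the named fact `hardy_infinite_zeros_on_critical_line` (rh.S14; Hardy 1914):
infinitely many zeros of `ζ` lie on the critical line, i.e. `{t : ℝ | ζ(1/2 + it) = 0}` is
infinite. Proof: `Literature.NumberTheory.LFunctions.Hardy.riemannZeta_zeros_on_critical_line_infinite` (Titchmarsh §10.2).
[cite: Hardy1914, C. R. Acad. Sci. Paris 158 (1914) 1012–1014] -/
theorem hardy_infinite_zeros_on_critical_line_holds : hardy_infinite_zeros_on_critical_line :=
  Hardy.riemannZeta_zeros_on_critical_line_infinite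

end Literature.NumberTheory.LFunctions
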